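import Literature.MathematicalPhysics.QuantumFieldTheory.KirchhoffFactorization
import Literature.MathematicalPhysics.QuantumFieldTheory.Borinsky2020.SecondSymanzikPermutahedron
import HarnessLib

/-!
# UV and IR factorisation of the second Symanzik polynomial, `Ξ_G = Ψ_γ Ξ_{G/γ} + R^{Ξ,UV}_{γ,G}` (`deg_γ R > h_γ`) and, for `γ` mass-momentum spanning, `Ξ_G = Ξ_γ Ψ_{G/γ} + R^{Ξ,IR}_{γ,G}` (`deg_γ R > h_γ + 1`); the printed DEFINITION of m.m., `γ m.m. ⟺ Ξ_{G/γ} = 0` (Brown 2017 Prop. 2.2 / Prop. 2.4 / Thm 2.7, eq. (2.5); Schultka 2018 Prop. 4.11, Cor. 4.12; Borinsky 2020 §7.1 = Borinsky–Munch–Tellander 2023 §3.3) — PROVED, in the tree's cycle-matroid vocabulary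

independent recomputation; certified where stated, statistical where stated; no new-physics claim.

CITATION HEADER (venture `QEDPrecision`, cell `pub-qed`, track TROPICAL, LIT seat `pub-qed-trop-lit` gen 31; VALUE-FREE: identities
between polynomials attached to an arbitrary connected edge list, an arbitrary edge subset `γ`, arbitrary vertex momenta in a real
normed group and arbitrary real masses; nothing per word, no integral, nothing of any Set V family). Sequel to
`KirchhoffFactorization.lean` (same seat, gen 29: the `Ψ`-law `Ψ_G|_{F_{−1_γ}} = Ψ_γ Ψ_{G/γ}`, Brown Prop. 2.2 first line) and to
`Borinsky2020/SecondSymanzikPermutahedron.lean` (gen 30: the second Symanzik polynomial `Φ_G` with masses = Brown's `Ξ_G`,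
spanning 2-forests, momentum flow, the COMBINATORIAL `IsMassMomentumSpanning`, `NP_{Φ_G} = 𝒢_{z_Φ}`), closing the items those
headers list as NOT typed: "the `Φ`-laws (Prop. 2.2's second line, Prop. 2.4 IR factorisation, Thm 2.7; Schultka (3)–(5))" and
"The print's other definition `Φ_{G/γ} = 0` (equivalent under generic kinematics, Brown eq. (2.3)/Lemma 1.13) is not typed: the
tree has no quotient graphs". As in the `Ψ`-companion, the quotient graph `G/γ` enters through the CONTRACTION `M(G)/γ` of the
cycle matroid and the subgraph `γ` through the RESTRICTION (bases / independent sets inside `γ`); the kinematics of `G/γ` and of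
`γ` are read off the components of edge sets of `G` (`momentumFlow`, `edgeGraph … Reachable`), so no new vertex type is needed.

SOURCES, VERBATIM. [Brown2017] F. Brown, "Feynman amplitudes, coaction principle, and cosmic Galois group", Commun. Number Theory
Phys. 11 (2017) 453–556 = arXiv:1512.06409v3 (held `paper:arxiv-1512.06409`; corpus chunks p0009, p0012–p0014), §1.4 (p0009:L14–L31):
"Definition 1.8. A set of edges γ ⊂ E_G is momentum-spanning if ∂E^ext_G ⊂ V_γ, and the vertices E^ext_G lie in a single connected
component of the graph (V_γ, E_γ). … (V_γ, E_γ, E^ext_γ) where E^ext_γ = E^ext_G if γ is momentum-spanning, and E^ext_γ = ∅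
otherwise. Thus the Feynman graph inherits all external momenta of G if it is momentum-spanning … The quotient of G by an
edge-subgraph γ is defined by G/γ = (V_G/∼, (E_G∖γ)/∼, E^ext_G/∼) where ∼ is the equivalence relation on vertices of G where two
vertices are equivalent if and only if they are vertices of the same connected component of γ … Every connected component of γ
corresponds to a unique vertex in G/γ. Note that γ is momentum-spanning if and only if G/γ is equivalent to a graph with no external
momenta (by momentum conservation). … exactly one of the two Feynman graphs γ and G/γ is equivalent to a Feynman graph with
non-zero external momenta: if γ is momentum spanning it is γ, otherwise it is G/γ." §2.1 (p0012:L8–L70): "let γ ⊂ E_G be an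
edge-subgraph with connected components γ_1,…,γ_n. **Lemma 2.1.** The map T ↦ (T/(T∩γ), T∩γ_1, …, T∩γ_n) is a bijection from:
{Spanning k-trees T such that γ_i ∩ T is connected for all i=1,…,n} to {Spanning k-trees in G/γ} × Π_{i=1}^n {Spanning trees
in γ_i}" · "**Proposition 2.2.** Let G be connected, γ ⊂ E_G as above. Then Ψ_G = Ψ_γ Ψ_{G/γ} + R^Ψ_{γ,G}, Φ_G(q) = Ψ_γ
Φ_{G/γ}(q) + R^{Φ,UV}_{γ,G}(q) where the degree of R^Ψ_{γ,G} and R^{Φ,UV}_{γ,G}(q) in the variables α_e, e ∈ E_γ is strictly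
greater than deg Ψ_γ = deg Π_{i=1}^n Ψ_{γ_i} = h_γ. Proof. We shall prove both formulae simultaneously. Let k=0 (resp. 1). … the
set of monomials in Ψ_G (resp. Φ_G(q)) are in one-to-one correspondence with the set of spanning k-trees T ⊂ G. The latter can
be partitioned into two subsets: those for which T ∩ γ_i is connected for all i, and those for which T ∩ γ_i is not connected for
some i. The former class is in one-to-one correspondence, by lemma 2.1, with the monomials in Ψ_{γ_1}…Ψ_{γ_n} × Ψ_{G/γ} (resp.
Ψ_{γ_1}…Ψ_{γ_n} × Φ_{G/γ}(q)). … the degree of the monomial Π_{e∉T} α_e in the variables α_e for e ∈ E_γ is … h_γ + Σ_i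
(κ_{T∩γ_i} − 1). This is strictly greater than h_γ whenever some T ∩ γ_i is not connected." · "Equivalently, setting α'_e = λ
α_e for e ∈ E_γ and α'_e = α_e otherwise, we have Ψ_G(α'_e) ≡ λ^{h_γ} Ψ_γ(α'_e) Ψ_{G/γ}(α'_e) (mod λ^{h_γ+1}), Φ_G(α'_e)(q) ≡
λ^{h_γ} Ψ_γ(α'_e) Φ_{G/γ}(q)(α'_e) (mod λ^{h_γ+1})". §2.2 (p0012:L75–L95, p0013:L1–L31): "With generic momenta (genericmomenta),
γ ⊂ E_G is momentum-spanning [footnote: If one wants to consider non-generic momentum configurations, one could take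
(PhiG/gammavanishing) as the definition of momentum-spanning. But in this case the factorisation theorems stated below will fail
without some additional assumptions on momenta. See example (Circle).] if and only if Φ_{G/γ}(q) = 0. (2.3) This follows
immediately from lemma 1.12. In this situation, the second factorization formula (UVfactorizations) is degenerate. It turns out
that the remainder term R^{Φ,UV}_{γ,G} can be further factorized via the following formula, which is apparently new.
**Proposition 2.4.** Let γ ⊂ E_G be a momentum spanning edge-subgraph. Then Φ_G(q) = Φ_γ(q) Ψ_{G/γ} + R^{Φ,IR}_{γ,G}(q) where
the degree of R^{Φ,IR}_{γ,G}(q) in the variables α_e, e ∈ E_γ is strictly greater than deg Φ_γ(q) = h_γ + 1. Proof. Suppose that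
γ has connected components γ', γ_1, …, γ_n such that γ' is momentum spanning. Monomials in Φ_G(q) are in one-to-one correspondence
with spanning 2-trees T = T_1 ∪ T_2 such that (q^{T_1})² ≠ 0. For such a 2-tree, T ∩ γ' cannot be connected because each component
T_i intersects γ' non-trivially (otherwise, V_{γ'} ∩ V_{T_i} = ∅ for some i, which implies that q^{T_i} = 0 because γ' is
momentum-spanning). Partition the set of spanning 2-trees such that (q^{T_1})² ≠ 0 into two classes: those such that T ∩ γ' has
2 components and T ∩ γ_i is connected for all i (call this class C_1), and those for which T ∩ γ' or some T ∩ γ_i has strictly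
more components (C_2). There is a bijection from the first set C_1 to {Spanning 2-trees in γ'} × {Spanning trees in G/γ} × Π_i
{Spanning trees in γ_i}. It is given by the map T ↦ (T ∩ γ', (T ∪ γ)/γ, T ∩ γ_1, …, T ∩ γ_n). … This gives a one-to-one
correspondence between the set C_1 and monomials in Φ_γ(q) = (Φ_{γ'}(q) Π_{i=1}^n Ψ_{γ_i}) Ψ_{G/γ}. Spanning 2-trees T in
the set C_2 are such that T ∩ γ' has at least 3 components, or some T ∩ γ_i has at least 2 components. In this case, the degree
… is … h_γ + (κ_{T∩γ'} − 1) + Σ_i (κ_{T∩γ_i} − 1), which is strictly greater than h_γ + 1, and contributes to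
R^{Φ,IR}_{γ,G}(q)." · Example 2.5 (Degenerate momenta) (p0013:L35–L53). §2.3 (p0013:L55–L88, p0014:L1–L8): "**Definition 2.6.**
A subgraph γ ⊂ G is mass-spanning if it contains all massive edges of G … γ is mass-momentum spanning (or simply m.m. for short)
if it is both mass and momentum-spanning. For generic kinematics (genericmassmomenta), a subgraph γ ⊂ E_G satisfies γ is m.m. ⟺
Ξ_{G/γ}(q,m) = 0. (2.5) This is a direct consequence of lemma 1.13. **Theorem 2.7.** Let G be a connected Feynman graph, and let
γ ⊂ E_G be an edge-subgraph with any number of connected components. Then Ξ_G(q,m) = Ψ_γ Ξ_{G/γ}(q,m) + R^{Ξ,UV}_{γ,G}(q,m)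
where R^{Ξ,UV}_{γ,G}(q,m) has degree > h_γ in the α_e, e ∈ E_γ. Now suppose that γ is a mass-momentum subgraph. In this case,
Ξ_G(q,m) = Ξ_γ(q,m) Ψ_{G/γ} + R^{Ξ,IR}_{γ,G}(q,m) where R^{Ξ,IR}_{γ,G}(q,m) has degree > h_γ+1 in the α_e, e ∈ E_γ. Proof.
For the proof of (XiUVfact) combine (UVfactorizations) with the definition (Xidefn) and set R^{Ξ,UV}_{γ,G}(q,m) =
R^{Φ,UV}_{γ,G}(q) + (Σ_{e∈E_γ} m_e² α_e) Ψ_γ Ψ_{G/γ} + (Σ_{e∈E_G} m_e² α_e) R^Ψ_{γ,G}. For (XiIRfact), combine the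
factorization formula for Ψ with the IR-factorization formula (IRfactPhi), use the condition m_e ≠ 0 ⇒ e ∈ E_γ, and set
R^{Ξ,IR}_{γ,G}(q,m) = R^{Φ,IR}_{γ,G}(q) + (Σ_{e∈E_G} m_e² α_e) R^Ψ_{γ,G}. … Note that the factorisation formula for Ψ_G,
which is symmetric with respect to γ and G/γ, occurs in both the UV and IR-factorizations of Ξ_G." [Schultka2018] K.
Schultka, "Toric geometry and regularization of Feynman integrals", arXiv:1806.01086 (HOME `data/lit/sources/.cache/1806.01086/
toricfeynman.tex`), §4 (l.2204–2214): "An edge subgraph γ ⊂ G containing all external vertices of G in a single connected component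
will be called momentum spanning. If γ additionally contains all massive edges, then it will be called mass-momentum spanning
(m.m. for short). For an m.m. subgraph γ, we set V^ext_γ = V^ext_G and E^M_γ = E^M_G and the kinematics of γ are the same as those of
G. Otherwise we consider γ to be scaleless … If γ is a possibly disconnected subgraph, we define the quotient G/γ by contracting
every connected component to a vertex. The kinematics of G/γ are inherited from G in the obvious way. This implies that G/γ has
nontrivial kinematics if and only if γ is not mass-momentum spanning."; (l.2219–2226): "If Γ = ∪_i Γ_i is the disjoint union of
connected graphs Γ_i, then we set ψ_Γ = Π_i ψ_{Γ_i} [printed with Σ, a typo for Π], φ_Γ = Σ_i φ_{Γ_i} Π_{j≠i} ψ_{Γ_j}, Φ_Γ = Σ_i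
Φ_{Γ_i} Π_{j≠i} ψ_{Γ_j}"; **Proposition 4.11** [citing Brown] (l.2236–2281): "(1) There are polynomials R^ψ_{G|γ}, R^φ_{G|γ}
and R^Φ_{G|γ}, such that ψ_G = ψ_{G|γ} + R^ψ_{G|γ}, φ_G = φ_{G|γ} + R^φ_{G|γ}, Φ_G = Φ_{G|γ} + R^Φ_{G|γ}. The degree
deg_γ(R^·_{G|γ}) of the rest terms in the variables (α_e)_{e∈γ} satisfies deg_γ(R^ψ_{G|γ}) > deg_γ(ψ_{G|γ}) = h¹_γ,
deg_γ(R^φ_{G|γ}) > deg_γ(φ_{G|γ}) = h¹_γ + δ^m_γ, deg_γ(R^Φ_{G|γ}) > deg_γ(Φ_{G|γ}) = h¹_γ + δ^{mm}_γ … (4) Suppose γ is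
momentum spanning and all external vertices are contained in the component γ_0. Then … (5) The polynomial R^Φ_{G|γ} is given
by R^Φ_{G|γ} = R^φ_{G|γ} + ψ_{G|γ}(Σ_{e∈E^M_G∩E_γ} m_e² α_e) + R^ψ_{G|γ}(Σ_{e∈E^M_G} m_e² α_e) if γ is not mass-momentum spanning
and by R^Φ_{G|γ} = R^φ_{G|γ} + R^ψ_{G|γ}(Σ_{e∈E^M_G} m_e² α_e) if γ is mass-momentum spanning."; proof sketch (l.2283–2308):
"If γ is not momentum spanning, then φ_{G|γ} = ψ_γ φ_{G/γ} … Now suppose γ is momentum spanning, such that all external vertices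
are contained in the component γ_0. Then the polynomial φ_{G/γ} vanishes and we have to use a different decomposition. In this
case, we define 𝒯̃²_γ to be those spanning 2-trees F, such that F ∩ γ_i are trees for i > 0 and F splits γ_0 into two connected
components. … gives the decomposition φ_G = φ_{γ_0} ψ_{γ_1}⋯ψ_{γ_k} ψ_{G/γ} + R^φ_{G|γ}"; **Corollary 4.12** (l.2310–2315):
"The face of P_G corresponding to the weight vector e^γ is F_{e^γ}P_G = P_γ × P_{G/γ}." [Borinsky2020] M. Borinsky, Ann. Inst.
Henri Poincaré D 10 (2023) 635–685 = arXiv:2008.12310v2 (HOME `data/lit/sources/.cache/2008.12310/tropical.tex`), §7.1 (l.1195):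
"A subgraph γ ⊂ G is called mass-momentum-spanning (m.m.) in G if the second Symanzik polynomial of the contracted graph G/γ
vanishes Φ_{G/γ} = 0. Mass-momentum-spanning graphs can also be defined combinatorially as subgraphs that contain all massive edges
and one connected component which connects all vertices with non-zero incoming momentum. See [Brown, Definition 2.6]"; (l.1205):
"this condition [non-exceptional kinematics] is not necessary if the combinatorial concept of mass-momentum-spanning is slightly
generalized while keeping the equivalence Φ_{G/γ} = 0 ⇔ mass-momentum-spanning"; proof of Theorem 32 (l.1217–1219): "The form of
the boolean functions z_{Ψ_G} and z_{Φ_G} follows directly from the factorization laws [Brown, Proposition 2.2, Proposition 2.4,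
Theorem 2.7]"; Definition 1 (the truncation `p_F`, l.302–306) as typed in `TropicalApproximation.lean`. [BorinskyMunchTellander2023]
CPC 292 (2023) 108874 = arXiv:2302.08955v2 (HOME `data/lit/sources/.cache/2302.08955/main.tex`), §3.3 (l.715–717): "We use the
following slightly generalized version of Brown's definition (see also [Borinsky 2020, Sec. 7.2]): We call a subgraph γ ⊂ E
mass-momentum spanning if the second Symanzik polynomial of the cograph G/γ vanishes identically ℱ_{G/γ} = 0." [Oxley2011] J. Oxley,
*Matroid Theory* (2nd ed., OUP 2011), §1.3–1.4 (bases of a restriction, closure), §3.1 (the contraction; for a graph `M(G/T) =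
M(G)/T`, Prop. 3.1.7 ff.) — cited for the DICTIONARY only, through Mathlib's `Matroid.contract`, `Matroid.IsBasis`.

TYPING. `E : Fin N → Fin (V+1) × Fin (V+1)` (edge list on `V+1` vertices), `M = cycleMatroid E`, `γ : Finset (Fin N)` an arbitrary
edge set, `Ψ_E = kirchhoffPolynomial ℝ E`, `Ξ_E = secondSymanzikPolynomial E p m` (the companion's `Φ_G` WITH masses = Brown's
`Ξ_G(q,m)`; momenta `p : Fin (V+1) → W` at the vertices, `W` a real normed group, masses `m : Fin N → ℝ`), `IsSpanningTree`,
`IsSpanningTwoForest`, `momentumFlow E F p` (momentum entering the root-side component of the graph spanned by `F`),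
`IsMassMomentumSpanning` (Brown Def. 2.6), `IsGenericMomenta` (Brown eq. (genericmomenta), vertex form), `edgeRank`, `loopNumber =
h`, `edgeGraph E γ` (the graph spanned by `γ` on all vertices) — all the companions'. DICTIONARY (the one place print ≠ tree): the
components `γ_i` of `γ` and the quotient GRAPH `G/γ` are not constructed; instead "spanning trees of the `γ_i`" = bases `F` of `γ`
in `M` (maximal forests), "spanning 2-trees of `γ' ` times spanning trees of the other `γ_i`" = independent `F' ⊆ γ` with `|F'| =
rk γ − 1`, "spanning k-trees of `G/γ`" = independent sets `T'` of the contraction `M/γ` with `|T'| = |V_{G/γ}| − k = |V_G| − rk γ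
− k` (`contract_isBase_iff_indep_card` for `k = 1`), and the momentum flowing between the two components of a 2-forest `S` of
`G/γ` = `momentumFlow E (γ ∪ S) p` (the components of `γ` play the vertices of `G/γ`: "The kinematics of G/γ are inherited from G in
the obvious way"); "deg_γ" of a monomial `x^d` is `Σ_{e∈γ} d_e`; the lowest-order part in the `γ`-variables is Borinsky's truncation
`trunc Ξ_E (−1_γ)` to the face of the Newton polytope exposed by `−1_γ` (`faceValue`, `pairing`, `setIndicator` of the companions).
DEFINITIONS (4, with bodies, each = a printed polynomial of the flat deformation `G|γ = γ ∪ G/γ` in this dictionary):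
**`kirchhoffSub E γ`** = `Ψ_γ = Π_i Ψ_{γ_i}` (sum over bases `F` of `γ` of `Π_{e∈γ∖F} x_e`); **`kirchhoffQuot E γ`** = `Ψ_{G/γ}`
(sum over bases `T'` of `M/γ`, `T' ⊆ E∖γ`, of `Π_{e∈(E∖γ)∖T'} x_e`) — these two are literally the factors of the `Ψ`-companion's
`trunc_kirchhoffPolynomial_neg_setIndicator` (`trunc_kirchhoffPolynomial_eq_kirchhoffSub_mul_kirchhoffQuot`); **`secondSymanzikQuot E
γ p m`** = `Ξ_{G/γ}(q,m) = Σ_{S 2-forest of G/γ} ‖p(γ ∪ S)‖² Π_{e∈(E∖γ)∖S} x_e + Ψ_{G/γ} Σ_{e∉γ} m_e² x_e`; **`secondSymanzikSub E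
γ p m a`** = `Ξ_γ(q,m)` with the kinematics of `G` READ FROM A VERTEX `a`: `Σ_{F' ⊆ γ indep, |F'| = rk γ − 1} ‖Σ_{v ~_{F'} a} p_v‖²
Π_{e∈γ∖F'} x_e + Ψ_γ Σ_{e∈γ} m_e² x_e` — for `a` in the momentum component `γ_0` this is Brown's `Ξ_γ = (Φ_{γ_0} Π_{i≥1} Ψ_{γ_i})
+ (Σ_{e∈γ} m_e² α_e) Ψ_γ` term by term (an `F'` that splits some `γ_i`, `i ≥ 1`, instead of `γ_0` gets the coefficient
`‖Σ_{v∈γ_0} p_v‖² = ‖Σ_v p_v‖² = 0` by conservation, so contributes the zero polynomial); the IR theorems carry the hypothesis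
`∀ v, p v ≠ 0 → a ~_γ v` ("all external vertices are contained in the component γ_0" ∋ `a`; vacuous choice of `a` when all momenta
vanish; from `IsMassMomentumSpanning` and `p a ≠ 0` by `IsMassMomentumSpanning.reachable_of_ne_zero`).

PROVED (0 named facts; 4 definitions; Mathlib + companions only). Part 0 (bookkeeping): `gammaDeg_sum_single` (`deg_γ x^{𝟙_S} =
|γ ∩ S|`), `forall_mem_support_add/sum/smul/mul` (monomials of sums/products), `gammaDeg_of_mem_support_prod_X`, `…_X`,
**`pairing_neg_setIndicator`** (`⟨−1_γ, d⟩ = −deg_γ x^d`). Part 1 (matroid plumbing): `edgeRank_union_eq_of_isBasis` (a maximal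
forest of `γ` spans `γ`: `rk(F ∪ T') = rk(γ ∪ T')`), **`momentumFlow_union_eq_of_isBasis`** (`p(F ∪ T') = p(γ ∪ T')`: the
kinematics of `G/γ`), **`sum_forests_inter_eq_sum_isBasis_sum_contract`** (LEMMA 2.1 for spanning `k`-forests, as a re-indexing
`S ↦ (S ∩ γ, S ∖ γ)` with inverse `∪`), `contract_isBase_iff_indep_card`. Part 3: `kirchhoffSub_ne_zero`, `kirchhoffQuot_ne_zero`
(Brown Lemma 1.11 for `γ`, `G/γ`), `gammaDeg_of_mem_support_kirchhoffSub` (`= h_γ`: "deg Ψ_γ = h_γ"), `…_kirchhoffQuot` (`= 0`),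
`…_secondSymanzikQuot` (`= 0`). Part 4: **`kirchhoffSub_mul_kirchhoffQuot`** (`Ψ_γ Ψ_{G/γ} = Σ_{T ∈ 𝒯¹_γ} Π_{e∉T} x_e`),
**`kirchhoffSub_mul_twoForestQuot`** (`Ψ_γ Φ_{G/γ}(q) = Σ_{T ∈ 𝒯²_γ} (q^{T_1})² Π_{e∉T} x_e`, flows of `G`). Part 5 (UV, Thm 2.7
first line / Prop. 2.2 second line / Schultka (1),(5) non-m.m. case): **`secondSymanzik_eq_kirchhoffSub_mul_quot_add`** (`Ξ_G = Ψ_γ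
Ξ_{G/γ} + R^{Ξ,UV}` with `R^{Ξ,UV} = R^{Φ,UV} + (Σ_{e∈γ} m_e² x_e) Ψ_γΨ_{G/γ} + (Σ_e m_e² x_e) R^Ψ` EXPLICIT as the printed three
terms — for EVERY connected edge list, every `γ`, all momenta and masses: no conservation, genericity or sign hypothesis),
**`le_gammaDeg_of_mem_support_uv_remainder`** ("R^{Ξ,UV} has degree > h_γ in the α_e, e ∈ E_γ": every monomial of `Ξ_G − Ψ_γ
Ξ_{G/γ}` has `deg_γ ≥ h_γ + 1`), `gammaDeg_of_mem_support_kirchhoffSub_mul_secondSymanzikQuot` (`= h_γ` on the leading part).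
Part 6 (eq. (2.5) / Borinsky's definition): **`secondSymanzikQuot_eq_zero_of_isMassMomentumSpanning`** (m.m. ⟹ `Ξ_{G/γ} = 0`, for
ALL conserved momenta), **`isMassMomentumSpanning_of_secondSymanzikQuot_eq_zero`** (`Ξ_{G/γ} = 0` ⟹ m.m., for conserved GENERIC
Euclidean momenta, via the companion's Theorem 32 face value `−z_Φ(γ)` and the UV remainder bound),
**`isMassMomentumSpanning_iff_secondSymanzikQuot_eq_zero`** (THE PRINTED DEFINITION ⟺ THE COMBINATORIAL ONE). Part 7 (Borinsky's
truncation): `faceValue_eq_and_trunc_eq_of_eq_add` (leading part of lower `y`-pairing-degree = truncation `p_{F_y}`, Definition 1),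
**`faceValue_and_trunc_secondSymanzik_neg_setIndicator`** (`Ξ_{G/γ} ≠ 0` ⟹ `Ξ_G|_{F_{−1_γ}} = Ψ_γ · Ξ_{G/γ}`, face value `−h_γ`),
**`trunc_secondSymanzik_neg_setIndicator_of_not_isMassMomentumSpanning`** (generic, `γ` not m.m.). Part 8 (IR, Prop. 2.4 / Thm 2.7
second line / Schultka (1),(4),(5) m.m. case): `secondSymanzikSub` and `gammaDeg_of_mem_support_secondSymanzikSub` (`= h_γ + 1`:
"deg Φ_γ(q) = h_γ + 1"), **`momentumFlow_eq_zero_of_card_inter_eq`** (a 2-forest meeting the momentum-spanning `γ` maximally has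
flow `0`: "T ∩ γ' cannot be connected … q^{T_i} = 0"), **`momentumFlow_eq_zero_of_not_contract_indep`** (nor does one whose outside
part fails to span `G/γ`), **`norm_momentumFlow_eq_of_contract_indep`** (class `C_1`: `‖p(T)‖ = ‖q^{(T∩γ)_1}‖`, independent of
`(T ∪ γ)/γ` — a strict-submodularity count inside the momentum component), **`sum_twoForests_submax_eq_sum_sum`** (the bijection
`C_1 → {2-trees in γ'}×Π{trees in γ_i} × {trees in G/γ}`), `twoForestSub_mul_kirchhoffQuot` (`Φ_γ(q) Ψ_{G/γ} = Σ_{T∈C_1}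
(q^{T_1})² Π_{e∉T} x_e`), **`secondSymanzik_eq_sub_mul_kirchhoffQuot_add`** (`Ξ_G = Ξ_γ Ψ_{G/γ} + R^{Ξ,IR}` with `R^{Ξ,IR} =
R^{Φ,IR} + (Σ_{e∈γ} m_e² x_e) R^Ψ` EXPLICIT, `R^{Φ,IR}` = class `C_2` — for γ m.m., momenta conserved, NOT necessarily generic),
**`le_gammaDeg_of_mem_support_ir_remainder`** ("degree > h_γ + 1": every monomial of `Ξ_G − Ξ_γ Ψ_{G/γ}` has `deg_γ ≥ h_γ + 2`),
`gammaDeg_of_mem_support_secondSymanzikSub_mul_kirchhoffQuot` (`= h_γ + 1`), **`faceValue_and_trunc_secondSymanzik_neg_setIndicator_of_mm`**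
(`Ξ_γ ≠ 0` ⟹ `Ξ_G|_{F_{−1_γ}} = Ξ_γ · Ψ_{G/γ}`, face value `−(h_γ+1)`), **`trunc_secondSymanzik_neg_setIndicator_of_isMassMomentumSpanning`**
(generic, `γ` m.m.: unconditionally). With Part 7 this is Borinsky's sentence "The form of the boolean functions z_Ψ and z_Φ follows
directly from the factorization laws" made explicit face by face (`−1_γ` for every `γ`), and Schultka's Cor. 4.12 "F_{e^γ}P_G =
P_γ × P_{G/γ}" at the level of the initial forms of `Ξ_G` (a product of a polynomial in the `γ`-variables and one in the others).

NOT typed / does NOT say: the quotient GRAPH `G/γ`, the components `γ_i` as graphs, Brown's subgraph `(V_γ, E_γ, E^ext_γ)` as a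
Feynman graph in its own right, and `M(G/γ) = M(G)/γ` (Oxley) — the dictionary above replaces them; Schultka's `φ`-line and his
iff-criteria (2)–(4) for the VANISHING of the rest terms (only the degree statements (1) and the formula (5) are typed, as explicit
remainders); Prop. 2.2 / 2.4 for the massless `Φ_G(q)` separately (they are the case `m = 0` of the typed `Ξ`-statements, not
restated); Brown's Example 2.5 and the "slightly generalized" m.m. notion of Borinsky l.1205 / BMT23 (the converse direction of
Part 6 is typed under `IsGenericMomenta` only, as printed in eq. (2.5)); Minkowski / pseudo-Euclidean kinematics (BMT23 Thm 3.6) and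
exceptional kinematics beyond what is stated; the contraction–deletion relations, the motic Hopf algebra, Theorem 2.7's use in
§3–§6 of Brown; anything about the forest formula / `K`-operation as an OPERATOR, Hepp sectors of a SUM of graphs, signed or
subtracted integrands, words, samplers or variance — these are the polynomial identities such constructions start from, nothing
more. (Filed by the pub-qed TROPICAL literature seat `pub-qed-trop-lit` gen 31; `tropical/lit/SOURCES.md` A38.)
-/
noncomputable section

namespace Literature.MathematicalPhysics.QuantumFieldTheory

open Finset MvPolynomial Matroid
open Literature.MathematicalPhysics.QuantumFieldTheory.Borinsky2020

variable {N V : ℕ} (E : Fin N → Fin (V + 1) × Fin (V + 1))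

/-! ## Part 0 — bookkeeping: square-free monomials and the `γ`-degree `deg_γ x^d = Σ_{e∈γ} d_e` -/

section Degree

/-- A square-free product of variables is the monomial of its exponent vector `Σ_{e∈S} 𝟙_e`. [folklore] -/
private theorem prod_X_eq_monomial' (S : Finset (Fin N)) :
    ∏ e ∈ S, (X e : MvPolynomial (Fin N) ℝ) = monomial (∑ e' ∈ S, Finsupp.single e' 1) 1 := by
  classical
  induction S using Finset.induction_on with
  | empty => simp
  | insert e S he ih =>
    rw [Finset.prod_insert he, Finset.sum_insert he, ih, ← pow_one (X e), X_pow_eq_monomial,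
      monomial_mul, one_mul]

/-- The exponent vector `Σ_{e∈S} 𝟙_e` is the indicator of `S`. [folklore] -/
private theorem sum_single_apply (S : Finset (Fin N)) (k : Fin N) :
    (∑ e' ∈ S, Finsupp.single e' (1 : ℕ) : Fin N →₀ ℕ) k = if k ∈ S then 1 else 0 := by
  rw [Finsupp.coe_finsetSum, Finset.sum_apply]
  simp [Finsupp.single_apply, eq_comm]

/-- The support of `Σ_{e∈S} 𝟙_e` is `S`. [folklore] -/
private theorem support_sum_single (S : Finset (Fin N)) :
    (∑ e' ∈ S, Finsupp.single e' (1 : ℕ) : Fin N →₀ ℕ).support = S := by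
  ext k
  rw [Finsupp.mem_support_iff, sum_single_apply]
  simp

/-- `S ↦ Σ_{e∈S} 𝟙_e` is injective. [folklore] -/
private theorem sum_single_injective {S T : Finset (Fin N)}
    (h : (∑ e' ∈ S, Finsupp.single e' (1 : ℕ) : Fin N →₀ ℕ) = ∑ e' ∈ T, Finsupp.single e' 1) : S = T := by
  have := congrArg Finsupp.support h
  rwa [support_sum_single, support_sum_single] at this

/-- **The `γ`-degree of a square-free monomial**: `deg_γ x^{𝟙_S} = |γ ∩ S|` ("the degree of the monomial Π_{e∉T} α_e in the
variables α_e for e ∈ E_γ", Brown, proof of Prop. 2.2). [cite: Brown2017, Prop. 2.2 (proof, arXiv:1512.06409 §2.1)] -/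
theorem gammaDeg_sum_single (S γ : Finset (Fin N)) :
    ∑ e ∈ γ, (∑ e' ∈ S, Finsupp.single e' (1 : ℕ) : Fin N →₀ ℕ) e = (γ ∩ S).card := by
  simp only [sum_single_apply]
  rw [Finset.sum_boole, Finset.filter_mem_eq_inter, Nat.cast_id]

/-- The `γ`-degree is additive on exponent vectors. [folklore] -/
private theorem gammaDeg_add (γ : Finset (Fin N)) (a b : Fin N →₀ ℕ) :
    ∑ e ∈ γ, (a + b) e = ∑ e ∈ γ, a e + ∑ e ∈ γ, b e := by
  simp only [Finsupp.add_apply, Finset.sum_add_distrib]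

/-- A property of all monomials of `p` and of `q` holds for all monomials of `p + q`. [folklore] -/
private theorem forall_mem_support_add {P : (Fin N →₀ ℕ) → Prop} {p q : MvPolynomial (Fin N) ℝ}
    (hp : ∀ d ∈ p.support, P d) (hq : ∀ d ∈ q.support, P d) : ∀ d ∈ (p + q).support, P d := by
  classical
  intro d hd
  rcases Finset.mem_union.1 (support_add hd) with h | h
  exacts [hp d h, hq d h]

/-- A property of all monomials of every `f i` holds for all monomials of `Σ_i f i`. [folklore] -/
private theorem forall_mem_support_sum {ι : Type*} {s : Finset ι} {f : ι → MvPolynomial (Fin N) ℝ}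
    {P : (Fin N →₀ ℕ) → Prop} (h : ∀ i ∈ s, ∀ d ∈ (f i).support, P d) :
    ∀ d ∈ (∑ i ∈ s, f i).support, P d := by
  classical
  intro d hd
  obtain ⟨i, hi, hdi⟩ := Finset.mem_biUnion.1 (support_sum hd)
  exact h i hi d hdi

/-- A property of all monomials of `p` holds for all monomials of `c • p`. [folklore] -/
private theorem forall_mem_support_smul {P : (Fin N →₀ ℕ) → Prop} {c : ℝ} {p : MvPolynomial (Fin N) ℝ}
    (hp : ∀ d ∈ p.support, P d) : ∀ d ∈ (c • p).support, P d :=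
  fun d hd => hp d (support_smul hd)

/-- Monomials of a product are products of monomials: if `P` holds on `supp p`, `Q` on `supp q` and `P a → Q b → R (a + b)`,
then `R` holds on `supp (p q)`. [folklore] -/
private theorem forall_mem_support_mul {P Q R : (Fin N →₀ ℕ) → Prop} {p q : MvPolynomial (Fin N) ℝ}
    (hp : ∀ d ∈ p.support, P d) (hq : ∀ d ∈ q.support, Q d) (hPQ : ∀ a b, P a → Q b → R (a + b)) :
    ∀ d ∈ (p * q).support, R d := by
  classical
  intro d hd
  obtain ⟨a, ha, b, hb, rfl⟩ := Finset.mem_add.1 (support_mul p q hd)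
  exact hPQ a b (hp a ha) (hq b hb)

/-- The only monomial of `Π_{e∈S} x_e` has `γ`-degree `|γ ∩ S|`. [cite: Brown2017, Prop. 2.2 (proof)] -/
theorem gammaDeg_of_mem_support_prod_X (S γ : Finset (Fin N)) :
    ∀ d ∈ (∏ e ∈ S, (X e : MvPolynomial (Fin N) ℝ)).support, ∑ e ∈ γ, d e = (γ ∩ S).card := by
  classical
  intro d hd
  rw [prod_X_eq_monomial'] at hd
  rw [Finset.mem_singleton.1 (support_monomial_subset hd), gammaDeg_sum_single]

/-- The only monomial of `x_e` has `γ`-degree `1` if `e ∈ γ` and `0` otherwise. [folklore] -/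
private theorem gammaDeg_of_mem_support_X (e : Fin N) (γ : Finset (Fin N)) :
    ∀ d ∈ (X e : MvPolynomial (Fin N) ℝ).support, ∑ e' ∈ γ, d e' = if e ∈ γ then 1 else 0 := by
  classical
  intro d hd
  rw [support_X, Finset.mem_singleton] at hd
  subst hd
  simp only [Finsupp.single_apply]
  rw [Finset.sum_ite_eq]

/-- **`⟨−1_γ, d⟩ = −deg_γ x^d`**: Borinsky's pairing of the exponent vector with the weight `−1_γ` is minus the `γ`-degree
(Schultka: "The corresponding monomial α^S … is then minimal in the variables (α_e)_{e∈γ}" ⟺ maximal for `−1_γ`).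
[cite: Schultka2018, Proposition 4.11 proof sketch (toricfeynman.tex l.2288–2289); Borinsky2020, §2 (faces F_y of NP_p, tropical.tex l.291)] -/
theorem pairing_neg_setIndicator (γ : Finset (Fin N)) (d : Fin N →₀ ℕ) :
    pairing (-setIndicator γ) d = -((∑ e ∈ γ, d e : ℕ) : ℝ) := by
  unfold pairing
  rw [Finset.sum_subset (Finset.subset_univ d.support)
    (fun i _ hi => by rw [Finsupp.notMem_support_iff.1 hi]; simp)]
  simp only [Pi.neg_apply, setIndicator, neg_mul, Finset.sum_neg_distrib, ite_mul, one_mul, zero_mul,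
    Finset.sum_ite_mem, Finset.univ_inter, Nat.cast_sum]

end Degree

/-! ## Part 1 — cycle-matroid plumbing: the closure of a maximal forest of `γ`, Lemma 2.1 for spanning `k`-forests -/

section MatroidPlumbing

/-- **A maximal forest of `γ` spans `γ`**: for a basis `F` of `γ` in the cycle matroid and any further edge set `T'`,
`rk(F ∪ T') = rk(γ ∪ T')` (the closure of `F` contains `γ`). [cite: Oxley2011, §1.4 (closure; Lemma 1.4.2 ff.); Schultka2018, §4 after Corollary 4.12 (T ∩ γ a maximal forest)] -/
theorem edgeRank_union_eq_of_isBasis {F γ : Finset (Fin N)}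
    (hF : (cycleMatroid E).IsBasis (F : Set (Fin N)) (γ : Set (Fin N))) (T' : Finset (Fin N)) :
    edgeRank E (F ∪ T') = edgeRank E (γ ∪ T') := by
  have h := hF.eRk_eq_eRk_union (T' : Set (Fin N))
  rw [← Finset.coe_union, ← Finset.coe_union, eRk_cycleMatroid_eq_edgeRank, eRk_cycleMatroid_eq_edgeRank,
    ENat.coe_inj] at h
  exact h

variable {W : Type*} [NormedAddCommGroup W]

/-- **The momentum flow of a 2-forest only sees the components of `γ`**: for a maximal forest `F` of `γ`, the graphs `F ∪ T'`
and `γ ∪ T'` have the same components (same rank, `reachable_iff_reachable_of_subset_of_edgeRank_eq`), hence the same root-side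
momentum `p(·)` — "the kinematics of G/γ are inherited from G in the obvious way" (each vertex of `G/γ` = a component of `γ`
carries the total momentum entering it). [cite: Schultka2018, §4 before Proposition 4.11 (toricfeynman.tex l.2209–2212); Brown2017, §1.4 (the quotient G/γ and its external momenta)] -/
theorem momentumFlow_union_eq_of_isBasis {F γ : Finset (Fin N)}
    (hF : (cycleMatroid E).IsBasis (F : Set (Fin N)) (γ : Set (Fin N))) (T' : Finset (Fin N))
    (p : Fin (V + 1) → W) : momentumFlow E (F ∪ T') p = momentumFlow E (γ ∪ T') p := by
  classical
  have hsub : F ∪ T' ⊆ γ ∪ T' := Finset.union_subset_union (Finset.coe_subset.1 hF.subset) (Finset.Subset.refl _)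
  have hrk := edgeRank_union_eq_of_isBasis E hF T'
  unfold momentumFlow
  exact Finset.sum_congr (Finset.filter_congr fun v _ =>
    reachable_iff_reachable_of_subset_of_edgeRank_eq E hsub hrk 0 v) fun _ _ => rfl

open scoped Classical in
/-- **Brown's Lemma 2.1 for spanning `k`-forests, in matroid form.** The map `S ↦ (S ∩ γ, S ∖ γ)` is a bijection from the
spanning `k`-forests `S` of `G` (independent, `|S| + k = |V_G|`) that meet `γ` in a MAXIMAL forest (`|S ∩ γ| = rk γ`, i.e. "γ_i ∩ S
is connected for all i") onto (maximal forests `F` of `γ`, i.e. bases of `γ`) × (spanning `k`-forests `T'` of `G/γ`, i.e. independent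
sets of the contraction `M(G)/γ` with `|T'| + k = |V_{G/γ}| = |V_G| − rk γ`), with inverse `(F, T') ↦ F ∪ T'` ("The map T ↦
(T/(T∩γ), T∩γ_1, …, T∩γ_n) is a bijection from {Spanning k-trees T such that γ_i ∩ T is connected for all i} to {Spanning k-trees
in G/γ} × Π_i {Spanning trees in γ_i}"); stated as the corresponding re-indexing of sums. [cite: Brown2017, Lemma 2.1 (arXiv:1512.06409 §2.1); Schultka2018, Proposition 4.11 proof sketch (toricfeynman.tex l.2283–2290); Oxley2011, §3.1 Prop. 3.1.7 (independent sets of a contraction)] -/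
theorem sum_forests_inter_eq_sum_isBasis_sum_contract (γ : Finset (Fin N)) (k : ℕ) {β : Type*} [AddCommMonoid β]
    (g : Finset (Fin N) → Finset (Fin N) → β) :
    ∑ S ∈ univ.filter (fun S : Finset (Fin N) =>
        edgeRank E S = S.card ∧ S.card + k = V + 1 ∧ (S ∩ γ).card = edgeRank E γ), g (S ∩ γ) (S \ γ) =
      ∑ F ∈ γ.powerset.filter
          (fun F : Finset (Fin N) => (cycleMatroid E).IsBasis (↑F : Set (Fin N)) (↑γ : Set (Fin N))),
        ∑ T' ∈ γᶜ.powerset.filter (fun T' : Finset (Fin N) =>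
            ((cycleMatroid E) ／ (↑γ : Set (Fin N))).Indep (↑T' : Set (Fin N)) ∧ T'.card + k + edgeRank E γ = V + 1),
          g F T' := by
  rw [← Finset.sum_product']
  symm
  refine Finset.sum_nbij' (fun q : Finset (Fin N) × Finset (Fin N) => q.1 ∪ q.2)
    (fun S : Finset (Fin N) => (S ∩ γ, S \ γ)) ?_ ?_ ?_ ?_ ?_
  · -- `(F, T') ↦ F ∪ T'` is a spanning `k`-forest meeting `γ` maximally
    rintro ⟨F, T'⟩ hq
    show F ∪ T' ∈ _
    rw [Finset.mem_product] at hq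
    obtain ⟨hF, hT'⟩ := hq
    rw [Finset.mem_filter, Finset.mem_powerset] at hF hT'
    have hdisj : Disjoint T' γ := Finset.disjoint_left.2 fun e he heγ => (Finset.mem_compl.1 (hT'.1 he)) heγ
    have hFγ := (isBasis_cycleMatroid_iff E F γ).1 hF.2
    have hind : (cycleMatroid E).Indep (((T' ∪ F : Finset (Fin N))) : Set (Fin N)) := by
      rw [Finset.coe_union]; exact ((hF.2.contract_indep_iff).1 hT'.2.1).1
    rw [indep_cycleMatroid_iff_edgeRank, Finset.union_comm] at hind
    have hcard : (F ∪ T').card = F.card + T'.card := Finset.card_union_of_disjoint (hdisj.symm.mono_left hFγ.1)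
    have hk : T'.card + k + edgeRank E γ = V + 1 := hT'.2.2
    have hFc : F.card = edgeRank E γ := hFγ.2.2
    rw [Finset.mem_filter]
    refine ⟨Finset.mem_univ _, hind, by omega, ?_⟩
    rw [Finset.union_inter_distrib_right, Finset.inter_eq_left.2 hFγ.1, Finset.disjoint_iff_inter_eq_empty.1 hdisj,
      Finset.union_empty, hFγ.2.2]
  · -- `S ↦ (S ∩ γ, S ∖ γ)` lands in (bases of γ) × (k-forests of M/γ)
    intro S hS
    simp only [Finset.mem_filter, Finset.mem_univ, true_and] at hS
    obtain ⟨hS1, hS2, hS3⟩ := hS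
    have hbasis : (cycleMatroid E).IsBasis ((S ∩ γ : Finset (Fin N)) : Set (Fin N)) (γ : Set (Fin N)) := by
      rw [isBasis_cycleMatroid_iff]
      exact ⟨Finset.inter_subset_right, edgeRank_eq_card_of_subset hS1 Finset.inter_subset_left, hS3⟩
    have hind : ((cycleMatroid E) ／ (γ : Set (Fin N))).Indep ((S \ γ : Finset (Fin N)) : Set (Fin N)) := by
      rw [hbasis.contract_indep_iff, ← Finset.coe_union, Finset.sdiff_union_inter, indep_cycleMatroid_iff_edgeRank,
        Finset.disjoint_coe]
      exact ⟨hS1, Finset.disjoint_sdiff⟩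
    have hcard := Finset.card_sdiff_add_card_inter S γ
    rw [Finset.mem_product]
    show S ∩ γ ∈ _ ∧ S \ γ ∈ _
    rw [Finset.mem_filter, Finset.mem_powerset, Finset.mem_filter, Finset.mem_powerset]
    exact ⟨⟨Finset.inter_subset_right, hbasis⟩, fun e he => Finset.mem_compl.2 (Finset.mem_sdiff.1 he).2, hind,
      by omega⟩
  · -- left inverse
    rintro ⟨F, T'⟩ hq
    rw [Finset.mem_product] at hq
    obtain ⟨hF, hT'⟩ := hq
    rw [Finset.mem_filter, Finset.mem_powerset] at hF hT'
    have hdisj : Disjoint T' γ := Finset.disjoint_left.2 fun e he heγ => (Finset.mem_compl.1 (hT'.1 he)) heγ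
    ext1
    · show (F ∪ T') ∩ γ = F
      rw [Finset.union_inter_distrib_right, Finset.inter_eq_left.2 hF.1, Finset.disjoint_iff_inter_eq_empty.1 hdisj,
        Finset.union_empty]
    · show (F ∪ T') \ γ = T'
      rw [Finset.union_sdiff_distrib, Finset.sdiff_eq_empty_iff_subset.2 hF.1, Finset.empty_union]
      exact sdiff_eq_left.2 hdisj
  · -- right inverse
    intro S _
    show S ∩ γ ∪ S \ γ = S
    rw [Finset.union_comm, Finset.sdiff_union_inter]
  · -- the summands agree
    rintro ⟨F, T'⟩ hq
    rw [Finset.mem_product] at hq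
    obtain ⟨hF, hT'⟩ := hq
    rw [Finset.mem_filter, Finset.mem_powerset] at hF hT'
    have hdisj : Disjoint T' γ := Finset.disjoint_left.2 fun e he heγ => (Finset.mem_compl.1 (hT'.1 he)) heγ
    show g F T' = g ((F ∪ T') ∩ γ) ((F ∪ T') \ γ)
    rw [Finset.union_inter_distrib_right, Finset.inter_eq_left.2 hF.1, Finset.disjoint_iff_inter_eq_empty.1 hdisj,
      Finset.union_empty, Finset.union_sdiff_distrib, Finset.sdiff_eq_empty_iff_subset.2 hF.1, Finset.empty_union,
      sdiff_eq_left.2 hdisj]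

/-- **Spanning trees of `G/γ`, two readings**: for a connected edge list and `T' ⊆ E ∖ γ`, `T'` is a base of the contraction `M(G)/γ`
iff it is independent there with `|T'| = |V_G| − 1 − rk γ` (`= |V_{G/γ}| − 1`, the vertices of `G/γ` being the components of `γ`).
[cite: Oxley2011, §3.1 Prop. 3.1.7 and eq. (3.1.6) (rank of a contraction); Brown2017, Lemma 2.1 (k = 1)] -/
theorem contract_isBase_iff_indep_card (hconn : IsConnectedEdgeList E) {γ T' : Finset (Fin N)} (hT' : T' ⊆ γᶜ) :
    ((cycleMatroid E) ／ (γ : Set (Fin N))).IsBase (T' : Set (Fin N)) ↔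
      ((cycleMatroid E) ／ (γ : Set (Fin N))).Indep (T' : Set (Fin N)) ∧ T'.card + 1 + edgeRank E γ = V + 1 := by
  obtain ⟨F, hF⟩ := exists_isBasis_cycleMatroid E γ
  have hdisj : Disjoint T' γ := Finset.disjoint_left.2 fun e he heγ => (Finset.mem_compl.1 (hT' he)) heγ
  have hdisj' : Disjoint (γ : Set (Fin N)) (T' : Set (Fin N)) := by
    rw [Finset.disjoint_coe]; exact hdisj.symm
  have hFγ := (isBasis_cycleMatroid_iff E F γ).1 hF
  have hcard : (T' ∪ F).card = T'.card + edgeRank E γ := by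
    rw [Finset.card_union_of_disjoint (hdisj.mono_right hFγ.1), hFγ.2.2]
  rw [contract_isBase_iff_of_isBasis E hF hdisj, isBase_cycleMatroid_iff_isSpanningTree E hconn,
    hF.contract_indep_iff_of_disjoint hdisj', ← Finset.coe_union, indep_cycleMatroid_iff_edgeRank, IsSpanningTree,
    hcard]
  omega

end MatroidPlumbing

/-! ## Part 2 — the four polynomials `Ψ_γ`, `Ψ_{G/γ}`, `Ξ_{G/γ}`, `Ξ_γ` of the flat deformation `G|γ = γ ∪ G/γ`, in matroid form -/

section Definitions

variable {W : Type*} [NormedAddCommGroup W]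

open scoped Classical in
/-- **`Ψ_γ = Π_i Ψ_{γ_i}`, the Kirchhoff polynomial of the (possibly disconnected) edge subgraph `γ`** ("ψ_Γ = Π_i ψ_{Γ_i}" for
`Γ = ∪_i Γ_i`; Brown: "deg Ψ_γ = deg Π_i Ψ_{γ_i} = h_γ"), in the variables of `γ`: one square-free monomial `Π_{e∈γ∖F} x_e` per
MAXIMAL SPANNING FOREST `F` of `γ` = basis of `γ` in the cycle matroid `M(G)` (= a choice of spanning tree in every component
`γ_i`). It is the first factor of the companion's `trunc_kirchhoffPolynomial_neg_setIndicator`.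
[cite: Brown2017, Prop. 2.2 (arXiv:1512.06409 §2.1); Schultka2018, §4 before Proposition 4.11 (toricfeynman.tex l.2219–2226) and after Corollary 4.12 (l.2318–2323); Oxley2011, §1.3 (bases of M|X)] -/
def kirchhoffSub (γ : Finset (Fin N)) : MvPolynomial (Fin N) ℝ :=
  ∑ F ∈ γ.powerset.filter
      (fun F : Finset (Fin N) => (cycleMatroid E).IsBasis (↑F : Set (Fin N)) (↑γ : Set (Fin N))),
    ∏ e ∈ γ \ F, X e

open scoped Classical in
/-- **`Ψ_{G/γ}`, the Kirchhoff polynomial of the quotient `G/γ`** (every component of `γ` contracted to a vertex), in the variables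
of `E ∖ γ`: one square-free monomial `Π_{e∈(E∖γ)∖T'} x_e` per spanning tree `T'` of `G/γ` = base of the CONTRACTION `M(G)/γ`
(Oxley: `M(G/T) = M(G)/T`). It is the second factor of the companion's `trunc_kirchhoffPolynomial_neg_setIndicator`.
[cite: Brown2017, §1.4 (the quotient G/γ) and Prop. 2.2; Schultka2018, Proposition 4.11 proof sketch (toricfeynman.tex l.2283–2296); Oxley2011, §3.1 Prop. 3.1.7 / eq. (3.1.2)] -/
def kirchhoffQuot (γ : Finset (Fin N)) : MvPolynomial (Fin N) ℝ :=
  ∑ T' ∈ γᶜ.powerset.filter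
      (fun T' : Finset (Fin N) => ((cycleMatroid E) ／ (↑γ : Set (Fin N))).IsBase (↑T' : Set (Fin N))),
    ∏ e ∈ γᶜ \ T', X e

open scoped Classical in
/-- **`Ξ_{G/γ}(q,m) = Φ_{G/γ}(q) + (Σ_{e∉γ} m_e² x_e) Ψ_{G/γ}`, the second Symanzik polynomial (with masses) of the QUOTIENT
`G/γ`** — the polynomial whose vanishing DEFINES "mass-momentum spanning" in Borinsky 2020 §7.1 ("A subgraph γ ⊂ G is called
mass-momentum-spanning (m.m.) in G if the second Symanzik polynomial of the contracted graph G/γ vanishes Φ_{G/γ} = 0") and in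
Borinsky–Munch–Tellander 2023 §3.3 ("ℱ_{G/γ} = 0") — in matroid form, variables of `E ∖ γ`: a spanning 2-forest of `G/γ` is an
independent set `T'` of the contraction `M(G)/γ` with `|T'| = |V_{G/γ}| − 2 = |V_G| − 2 − rk γ`; its two components are those of the
graph `γ ∪ T'` on `V_G` ("The kinematics of G/γ are inherited from G in the obvious way": the vertex of `G/γ` that is the
component `γ_i` receives the total momentum entering `γ_i`), so the momentum flowing between them is the companion's
`momentumFlow E (γ ∪ T') p`; the masses are those of the edges of `G/γ`, i.e. of `E ∖ γ`. Euclidean kinematics as in the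
companion (`‖·‖²` in a real normed group `W`). [cite: Borinsky2020, §7.1 (tropical.tex l.1195); BorinskyMunchTellander2023, §3.3 (main.tex l.733–736); Brown2017, §1.4 and Thm 2.7 eq. (XiUVfact); Schultka2018, §4 before Proposition 4.11 (toricfeynman.tex l.2209–2214)] -/
def secondSymanzikQuot (γ : Finset (Fin N)) (p : Fin (V + 1) → W) (m : Fin N → ℝ) : MvPolynomial (Fin N) ℝ :=
  (∑ T' ∈ γᶜ.powerset.filter (fun T' : Finset (Fin N) =>
      ((cycleMatroid E) ／ (↑γ : Set (Fin N))).Indep (↑T' : Set (Fin N)) ∧ T'.card + 2 + edgeRank E γ = V + 1),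
      ‖momentumFlow E (γ ∪ T') p‖ ^ 2 • ∏ e ∈ γᶜ \ T', X e) +
    kirchhoffQuot E γ * ∑ e ∈ γᶜ, m e ^ 2 • X e

end Definitions

/-! ## Part 3 — first properties: `Ψ_γ ≠ 0`, `Ψ_{G/γ} ≠ 0`; the `γ`-degrees of their monomials -/

section Basic

variable {W : Type*} [NormedAddCommGroup W]

/-- The companion's factorisation of `Ψ_G` in the present vocabulary: `Ψ_G|_{F_{−1_γ}} = Ψ_γ · Ψ_{G/γ}` (Brown Prop. 2.2, first line).
[cite: Brown2017, Prop. 2.2; Schultka2018, Proposition 4.11 (1)] -/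
theorem trunc_kirchhoffPolynomial_eq_kirchhoffSub_mul_kirchhoffQuot (hconn : IsConnectedEdgeList E) (γ : Finset (Fin N)) :
    trunc (kirchhoffPolynomial ℝ E) (-setIndicator γ) = kirchhoffSub E γ * kirchhoffQuot E γ :=
  trunc_kirchhoffPolynomial_neg_setIndicator E hconn γ

/-- **`Ψ_γ ≠ 0`**: `γ` has a maximal spanning forest, and distinct forests give distinct monomials (Brown Lemma 1.11: "Ψ_G ≠ 0
for every graph"). [cite: Brown2017, Lemma 1.11 (arXiv:1512.06409 §1.6); Oxley2011, §1.3 (every set has a basis)] -/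
theorem kirchhoffSub_ne_zero (γ : Finset (Fin N)) : kirchhoffSub E γ ≠ 0 := by
  classical
  obtain ⟨F₀, hF₀⟩ := exists_isBasis_cycleMatroid E γ
  have hF₀γ := (isBasis_cycleMatroid_iff E F₀ γ).1 hF₀
  intro h
  have hc := congrArg (coeff (∑ e' ∈ γ \ F₀, Finsupp.single e' (1 : ℕ))) h
  rw [kirchhoffSub, coeff_sum, coeff_zero] at hc
  simp only [prod_X_eq_monomial', coeff_monomial] at hc
  rw [Finset.sum_eq_single_of_mem F₀ (Finset.mem_filter.2 ⟨Finset.mem_powerset.2 hF₀γ.1, hF₀⟩)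
    (fun F hF hne => if_neg fun heq => hne ?_), if_pos rfl] at hc
  · exact one_ne_zero hc
  · have hFγ : F ⊆ γ := Finset.mem_powerset.1 (Finset.mem_filter.1 hF).1
    rw [← Finset.sdiff_sdiff_eq_self hFγ, sum_single_injective heq, Finset.sdiff_sdiff_eq_self hF₀γ.1]

/-- **`Ψ_{G/γ} ≠ 0`**: the contraction has a base (Brown Lemma 1.11 for the quotient graph). [cite: Brown2017, Lemma 1.11; Oxley2011, §3.1 (the contraction is a matroid)] -/
theorem kirchhoffQuot_ne_zero (γ : Finset (Fin N)) : kirchhoffQuot E γ ≠ 0 := by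
  classical
  obtain ⟨B, hB⟩ := ((cycleMatroid E) ／ (γ : Set (Fin N))).exists_isBase
  obtain ⟨T₀, rfl⟩ : ∃ T₀ : Finset (Fin N), (T₀ : Set (Fin N)) = B := ⟨(Set.toFinite B).toFinset, by simp⟩
  have hT₀ : T₀ ⊆ γᶜ := by
    intro e he
    have := hB.subset_ground he
    rw [contract_ground, cycleMatroid_ground] at this
    exact Finset.mem_compl.2 fun h => this.2 h
  intro h
  have hc := congrArg (coeff (∑ e' ∈ γᶜ \ T₀, Finsupp.single e' (1 : ℕ))) h
  rw [kirchhoffQuot, coeff_sum, coeff_zero] at hc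
  simp only [prod_X_eq_monomial', coeff_monomial] at hc
  rw [Finset.sum_eq_single_of_mem T₀ (Finset.mem_filter.2 ⟨Finset.mem_powerset.2 hT₀, hB⟩)
    (fun T hT hne => if_neg fun heq => hne ?_), if_pos rfl] at hc
  · exact one_ne_zero hc
  · have hTγ : T ⊆ γᶜ := Finset.mem_powerset.1 (Finset.mem_filter.1 hT).1
    rw [← Finset.sdiff_sdiff_eq_self hTγ, sum_single_injective heq, Finset.sdiff_sdiff_eq_self hT₀]

/-- **Every monomial of `Ψ_γ` has `γ`-degree `h_γ`** ("deg Ψ_γ = deg Π_i Ψ_{γ_i} = h_γ"; `|γ ∖ F| = |γ| − rk γ = ℓ(γ)`).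
[cite: Brown2017, Prop. 2.2; Schultka2018, Proposition 4.11 (1) ("deg_γ(ψ_{G|γ}) = h¹_γ")] -/
theorem gammaDeg_of_mem_support_kirchhoffSub {γ : Finset (Fin N)} {d : Fin N →₀ ℕ}
    (hd : d ∈ (kirchhoffSub E γ).support) : ∑ e ∈ γ, d e = loopNumber E γ := by
  classical
  unfold kirchhoffSub at hd
  refine forall_mem_support_sum (P := fun d => ∑ e ∈ γ, d e = loopNumber E γ) (fun F hF d hd => ?_) d hd
  have hFγ := (isBasis_cycleMatroid_iff E F γ).1 (Finset.mem_filter.1 hF).2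
  rw [gammaDeg_of_mem_support_prod_X _ γ d hd, Finset.inter_eq_right.2 Finset.sdiff_subset,
    Finset.card_sdiff_of_subset hFγ.1, hFγ.2.2, loopNumber]

/-- Every monomial of `Ψ_{G/γ}` has `γ`-degree `0` (it lives in the variables of `E ∖ γ`). [cite: Brown2017, Prop. 2.2] -/
theorem gammaDeg_of_mem_support_kirchhoffQuot {γ : Finset (Fin N)} {d : Fin N →₀ ℕ}
    (hd : d ∈ (kirchhoffQuot E γ).support) : ∑ e ∈ γ, d e = 0 := by
  classical
  unfold kirchhoffQuot at hd
  refine forall_mem_support_sum (P := fun d => ∑ e ∈ γ, d e = 0) (fun T' _ d hd => ?_) d hd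
  rw [gammaDeg_of_mem_support_prod_X _ γ d hd, Finset.card_eq_zero, ← Finset.disjoint_iff_inter_eq_empty]
  exact Finset.disjoint_left.2 fun e he he' => (Finset.mem_compl.1 (Finset.mem_sdiff.1 he').1) he

/-- Every monomial of `Ξ_{G/γ}` has `γ`-degree `0` (it lives in the variables of `E ∖ γ`). [cite: Brown2017, Thm 2.7 eq. (XiUVfact)] -/
theorem gammaDeg_of_mem_support_secondSymanzikQuot {γ : Finset (Fin N)} {p : Fin (V + 1) → W} {m : Fin N → ℝ}
    {d : Fin N →₀ ℕ} (hd : d ∈ (secondSymanzikQuot E γ p m).support) : ∑ e ∈ γ, d e = 0 := by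
  classical
  unfold secondSymanzikQuot at hd
  refine forall_mem_support_add (P := fun d => ∑ e ∈ γ, d e = 0) ?_ ?_ d hd
  · refine forall_mem_support_sum fun T' _ => forall_mem_support_smul fun d hd => ?_
    rw [gammaDeg_of_mem_support_prod_X _ γ d hd, Finset.card_eq_zero, ← Finset.disjoint_iff_inter_eq_empty]
    exact Finset.disjoint_left.2 fun e he he' => (Finset.mem_compl.1 (Finset.mem_sdiff.1 he').1) he
  · refine forall_mem_support_mul (P := fun d => ∑ e ∈ γ, d e = 0) (Q := fun d => ∑ e ∈ γ, d e = 0)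
      (fun d hd => gammaDeg_of_mem_support_kirchhoffQuot E hd)
      (forall_mem_support_sum fun e he => forall_mem_support_smul fun d hd => ?_)
      (fun a b ha hb => by rw [gammaDeg_add, ha, hb])
    rw [gammaDeg_of_mem_support_X e γ d hd, if_neg (Finset.mem_compl.1 he)]

end Basic

/-! ## Part 4 — Lemma 2.1 at work: `Ψ_γ Ψ_{G/γ}` = the spanning trees meeting `γ` maximally, `Ψ_γ Φ_{G/γ}` = the spanning 2-forests meeting `γ` maximally -/

section Pieces

variable {W : Type*} [NormedAddCommGroup W]

/-- The monomial bookkeeping of Lemma 2.1's bijection: `Π_{e∈γ∖(S∩γ)} x_e · Π_{e∈(E∖γ)∖(S∖γ)} x_e = Π_{e∉S} x_e`. [folklore] -/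
private theorem prod_sdiff_inter_mul_prod_compl_sdiff (S γ : Finset (Fin N)) :
    (∏ e ∈ γ \ (S ∩ γ), (X e : MvPolynomial (Fin N) ℝ)) * ∏ e ∈ γᶜ \ (S \ γ), X e = ∏ e ∈ Sᶜ, X e := by
  have h1 : γ \ (S ∩ γ) = γ \ S := Finset.sdiff_inter_self_right γ S
  have h2 : γᶜ \ (S \ γ) = γᶜ \ S := by
    ext e
    simp only [Finset.mem_sdiff, Finset.mem_compl]
    tauto
  have h3 : Sᶜ = (γ \ S) ∪ (γᶜ \ S) := by
    ext e
    simp only [Finset.mem_compl, Finset.mem_union, Finset.mem_sdiff]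
    tauto
  have hd : Disjoint (γ \ S) (γᶜ \ S) :=
    Finset.disjoint_left.2 fun e he he' => (Finset.mem_compl.1 (Finset.mem_sdiff.1 he').1) (Finset.mem_sdiff.1 he).1
  rw [h1, h2, h3, Finset.prod_union hd]

open scoped Classical in
/-- **`Ψ_γ · Ψ_{G/γ} = Σ_{T ∈ 𝒯¹_γ} Π_{e∉T} x_e`** — the product of the two Kirchhoff polynomials of the flat deformation is the sum of
the co-tree monomials of the spanning trees `T` of `G` that meet `γ` in a maximal forest (Schultka's `𝒯¹_γ`: "those spanning
k-trees, such that Σ_i |T ∩ γ_i| is maximal"), by Lemma 2.1 with `k = 1`. [cite: Schultka2018, Proposition 4.11 proof sketch (toricfeynman.tex l.2283–2292); Brown2017, Lemma 2.1 and Prop. 2.2 (proof)] -/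
theorem kirchhoffSub_mul_kirchhoffQuot (hconn : IsConnectedEdgeList E) (γ : Finset (Fin N)) :
    kirchhoffSub E γ * kirchhoffQuot E γ =
      ∑ T ∈ univ.filter (fun T : Finset (Fin N) => IsSpanningTree E T ∧ (T ∩ γ).card = edgeRank E γ),
        ∏ e ∈ Tᶜ, (X e : MvPolynomial (Fin N) ℝ) := by
  have hQ : kirchhoffQuot E γ = ∑ T' ∈ γᶜ.powerset.filter (fun T' : Finset (Fin N) =>
      ((cycleMatroid E) ／ (↑γ : Set (Fin N))).Indep (↑T' : Set (Fin N)) ∧ T'.card + 1 + edgeRank E γ = V + 1),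
        ∏ e ∈ γᶜ \ T', (X e : MvPolynomial (Fin N) ℝ) := by
    unfold kirchhoffQuot
    exact Finset.sum_congr (Finset.filter_congr fun T' hT' =>
      contract_isBase_iff_indep_card E hconn (Finset.mem_powerset.1 hT')) fun _ _ => rfl
  set g : Finset (Fin N) → Finset (Fin N) → MvPolynomial (Fin N) ℝ :=
    fun F T' => (∏ e ∈ γ \ F, X e) * ∏ e ∈ γᶜ \ T', X e with hg
  calc kirchhoffSub E γ * kirchhoffQuot E γ
      = ∑ F ∈ γ.powerset.filter
            (fun F : Finset (Fin N) => (cycleMatroid E).IsBasis (↑F : Set (Fin N)) (↑γ : Set (Fin N))),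
          ∑ T' ∈ γᶜ.powerset.filter (fun T' : Finset (Fin N) =>
              ((cycleMatroid E) ／ (↑γ : Set (Fin N))).Indep (↑T' : Set (Fin N)) ∧ T'.card + 1 + edgeRank E γ = V + 1),
            g F T' := by
        rw [kirchhoffSub, hQ, Finset.sum_mul_sum]
    _ = ∑ S ∈ univ.filter (fun S : Finset (Fin N) =>
          edgeRank E S = S.card ∧ S.card + 1 = V + 1 ∧ (S ∩ γ).card = edgeRank E γ), g (S ∩ γ) (S \ γ) :=
        (sum_forests_inter_eq_sum_isBasis_sum_contract E γ 1 g).symm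
    _ = _ := by
        refine Finset.sum_congr (Finset.filter_congr fun S _ => ?_) fun S _ => ?_
        · rw [IsSpanningTree]
          omega
        · rw [hg]
          exact prod_sdiff_inter_mul_prod_compl_sdiff S γ

open scoped Classical in
/-- **`Ψ_γ · Φ_{G/γ}(q) = Σ_{T ∈ 𝒯²_γ} (q^{T_1})² Π_{e∉T} x_e`** — the Kirchhoff polynomial of `γ` times the 2-forest part of
`Ξ_{G/γ}` is the sum over the spanning 2-forests `T` of `G` meeting `γ` in a maximal forest, WITH THE MOMENTUM FLOW OF `G` (Lemma 2.1
with `k = 2`; the flow of `F ∪ T'` is that of `γ ∪ T'`, `momentumFlow_union_eq_of_isBasis`: "The former class is in one-to-one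
correspondence, by lemma 2.1, with the monomials in Ψ_{γ_1}…Ψ_{γ_n} × Φ_{G/γ}(q)"). No hypothesis on the momenta.
[cite: Brown2017, Prop. 2.2 (proof) and Lemma 2.1 (arXiv:1512.06409 §2.1); Schultka2018, Proposition 4.11 proof sketch (toricfeynman.tex l.2283–2294)] -/
theorem kirchhoffSub_mul_twoForestQuot (γ : Finset (Fin N)) (p : Fin (V + 1) → W) :
    kirchhoffSub E γ *
        (∑ T' ∈ γᶜ.powerset.filter (fun T' : Finset (Fin N) =>
            ((cycleMatroid E) ／ (↑γ : Set (Fin N))).Indep (↑T' : Set (Fin N)) ∧ T'.card + 2 + edgeRank E γ = V + 1),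
          ‖momentumFlow E (γ ∪ T') p‖ ^ 2 • ∏ e ∈ γᶜ \ T', (X e : MvPolynomial (Fin N) ℝ)) =
      ∑ F₂ ∈ univ.filter (fun F₂ : Finset (Fin N) => IsSpanningTwoForest E F₂ ∧ (F₂ ∩ γ).card = edgeRank E γ),
        ‖momentumFlow E F₂ p‖ ^ 2 • ∏ e ∈ F₂ᶜ, (X e : MvPolynomial (Fin N) ℝ) := by
  set g : Finset (Fin N) → Finset (Fin N) → MvPolynomial (Fin N) ℝ :=
    fun F T' => ‖momentumFlow E (γ ∪ T') p‖ ^ 2 • ((∏ e ∈ γ \ F, X e) * ∏ e ∈ γᶜ \ T', X e) with hg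
  calc kirchhoffSub E γ * _
      = ∑ F ∈ γ.powerset.filter
            (fun F : Finset (Fin N) => (cycleMatroid E).IsBasis (↑F : Set (Fin N)) (↑γ : Set (Fin N))),
          ∑ T' ∈ γᶜ.powerset.filter (fun T' : Finset (Fin N) =>
              ((cycleMatroid E) ／ (↑γ : Set (Fin N))).Indep (↑T' : Set (Fin N)) ∧ T'.card + 2 + edgeRank E γ = V + 1),
            g F T' := by
        rw [kirchhoffSub, Finset.sum_mul_sum]
        refine Finset.sum_congr rfl fun F _ => Finset.sum_congr rfl fun T' _ => ?_
        rw [hg, mul_smul_comm]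
    _ = ∑ S ∈ univ.filter (fun S : Finset (Fin N) =>
          edgeRank E S = S.card ∧ S.card + 2 = V + 1 ∧ (S ∩ γ).card = edgeRank E γ), g (S ∩ γ) (S \ γ) :=
        (sum_forests_inter_eq_sum_isBasis_sum_contract E γ 2 g).symm
    _ = _ := by
        refine Finset.sum_congr (Finset.filter_congr fun S _ => ?_) fun S hS => ?_
        · rw [IsSpanningTwoForest]
          omega
        · simp only [Finset.mem_filter, Finset.mem_univ, true_and] at hS
          have hbasis : (cycleMatroid E).IsBasis ((S ∩ γ : Finset (Fin N)) : Set (Fin N)) (γ : Set (Fin N)) := by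
            rw [isBasis_cycleMatroid_iff]
            exact ⟨Finset.inter_subset_right, edgeRank_eq_card_of_subset hS.1.2 Finset.inter_subset_left, hS.2⟩
          simp only [hg]
          rw [← momentumFlow_union_eq_of_isBasis E hbasis, Finset.union_comm, Finset.sdiff_union_inter,
            prod_sdiff_inter_mul_prod_compl_sdiff S γ]

open scoped Classical in
/-- Splitting the 2-forest sum of `Φ_G` by `|T₂ ∩ γ| = rk γ` versus `< rk γ` (`T₂ ∩ γ` is a forest of `γ`, so `≤` always).
[cite: Brown2017, Prop. 2.2 (proof: "The latter can be partitioned into two subsets")] -/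
private theorem sum_twoForest_split (γ : Finset (Fin N)) (f : Finset (Fin N) → MvPolynomial (Fin N) ℝ) :
    ∑ F₂ ∈ univ.filter (IsSpanningTwoForest E), f F₂ =
      (∑ F₂ ∈ univ.filter (fun F₂ : Finset (Fin N) => IsSpanningTwoForest E F₂ ∧ (F₂ ∩ γ).card = edgeRank E γ),
          f F₂) +
        ∑ F₂ ∈ univ.filter (fun F₂ : Finset (Fin N) => IsSpanningTwoForest E F₂ ∧ (F₂ ∩ γ).card < edgeRank E γ),
          f F₂ := by
  rw [← Finset.sum_filter_add_sum_filter_not (univ.filter (IsSpanningTwoForest E))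
    (fun F₂ : Finset (Fin N) => (F₂ ∩ γ).card = edgeRank E γ), Finset.filter_filter, Finset.filter_filter]
  congr 1
  refine Finset.sum_congr (Finset.filter_congr fun F₂ _ => ?_) fun _ _ => rfl
  constructor
  · rintro ⟨hF, hne⟩
    have hle : (F₂ ∩ γ).card ≤ edgeRank E γ := by
      rw [← edgeRank_eq_card_of_subset hF.2 Finset.inter_subset_left]
      exact edgeRank_mono Finset.inter_subset_right
    exact ⟨hF, lt_of_le_of_ne hle hne⟩
  · rintro ⟨hF, hlt⟩
    exact ⟨hF, ne_of_lt hlt⟩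

open scoped Classical in
/-- Splitting `Ψ_G = Σ_T Π_{e∉T} x_e` by `|T ∩ γ| = rk γ` versus `< rk γ` (`T ∩ γ` is a forest of `γ`, so `≤` always). The set
equalities are proved through `Finset.mem_filter`, so the statement does not depend on which decidability instance for
`IsSpanningTree` the matrix-tree file used. [cite: Brown2017, Prop. 2.2 (proof: "The latter can be partitioned into two subsets")] -/
private theorem kirchhoffPolynomial_split (γ : Finset (Fin N)) :
    kirchhoffPolynomial ℝ E =
      (∑ T ∈ univ.filter (fun T : Finset (Fin N) => IsSpanningTree E T ∧ (T ∩ γ).card = edgeRank E γ),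
          ∏ e ∈ Tᶜ, (X e : MvPolynomial (Fin N) ℝ)) +
        ∑ T ∈ univ.filter (fun T : Finset (Fin N) => IsSpanningTree E T ∧ (T ∩ γ).card < edgeRank E γ),
          ∏ e ∈ Tᶜ, (X e : MvPolynomial (Fin N) ℝ) := by
  rw [kirchhoffPolynomial_eq_sum_spanningTrees,
    ← Finset.sum_filter_add_sum_filter_not _ (fun T : Finset (Fin N) => (T ∩ γ).card = edgeRank E γ)]
  congr 1
  · refine Finset.sum_congr ?_ fun _ _ => rfl
    ext T
    simp only [Finset.mem_filter, Finset.mem_univ, true_and]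
  · refine Finset.sum_congr ?_ fun _ _ => rfl
    ext T
    simp only [Finset.mem_filter, Finset.mem_univ, true_and]
    constructor
    · rintro ⟨hT, hne⟩
      exact ⟨hT, lt_of_le_of_ne (hT.card_inter_le_edgeRank γ) hne⟩
    · rintro ⟨hT, hlt⟩
      exact ⟨hT, ne_of_lt hlt⟩

end Pieces

/-! ## Part 5 — THE UV FACTORISATION `Ξ_G(q,m) = Ψ_γ · Ξ_{G/γ}(q,m) + R^{Ξ,UV}_{γ,G}(q,m)`, `deg_γ R > h_γ` (Brown Thm 2.7 eq. (XiUVfact); Prop. 2.2 second line for `m = 0`) -/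

section UV

variable {W : Type*} [NormedAddCommGroup W]

open scoped Classical in
/-- **Brown 2017 Theorem 2.7, the UV line, with the remainder EXPLICIT: `Ξ_G(q,m) = Ψ_γ Ξ_{G/γ}(q,m) + R^{Ξ,UV}_{γ,G}(q,m)`**, where
(Brown's proof: "combine (UVfactorizations) with the definition (Xidefn) and set R^{Ξ,UV}_{γ,G} = R^{Φ,UV}_{γ,G}(q) + (Σ_{e∈E_γ}
m_e² α_e) Ψ_γ Ψ_{G/γ} + (Σ_{e∈E_G} m_e² α_e) R^Ψ_{γ,G}") the three remainder pieces are: `R^{Φ,UV}` = the spanning 2-forests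
meeting `γ` in FEWER than `rk γ` edges ("those for which T ∩ γ_i is not connected for some i"); the `γ`-masses times
`Ψ_γ Ψ_{G/γ}` (= the spanning trees meeting `γ` maximally, `kirchhoffSub_mul_kirchhoffQuot`); and all masses times `R^Ψ` (the
spanning trees meeting `γ` in fewer than `rk γ` edges). An identity of polynomials for EVERY connected edge list, every edge set
`γ`, all momenta and masses (no conservation, genericity or Euclidean hypothesis enters). [cite: Brown2017, Thm 2.7 eq. (XiUVfact) and its proof, Prop. 2.2 (arXiv:1512.06409 §2.1, §2.3); Schultka2018, Proposition 4.11 (1),(5) (toricfeynman.tex l.2236–2281)] -/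
theorem secondSymanzik_eq_kirchhoffSub_mul_quot_add (hconn : IsConnectedEdgeList E) (γ : Finset (Fin N))
    (p : Fin (V + 1) → W) (m : Fin N → ℝ) :
    secondSymanzikPolynomial E p m =
      kirchhoffSub E γ * secondSymanzikQuot E γ p m +
        ((∑ F₂ ∈ univ.filter (fun F₂ : Finset (Fin N) => IsSpanningTwoForest E F₂ ∧ (F₂ ∩ γ).card < edgeRank E γ),
            ‖momentumFlow E F₂ p‖ ^ 2 • ∏ e ∈ F₂ᶜ, (X e : MvPolynomial (Fin N) ℝ)) +
          (∑ T ∈ univ.filter (fun T : Finset (Fin N) => IsSpanningTree E T ∧ (T ∩ γ).card = edgeRank E γ),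
              ∏ e ∈ Tᶜ, (X e : MvPolynomial (Fin N) ℝ)) * (∑ e ∈ γ, m e ^ 2 • X e) +
          (∑ T ∈ univ.filter (fun T : Finset (Fin N) => IsSpanningTree E T ∧ (T ∩ γ).card < edgeRank E γ),
              ∏ e ∈ Tᶜ, (X e : MvPolynomial (Fin N) ℝ)) * ∑ e, m e ^ 2 • X e) := by
  have hm : (∑ e, m e ^ 2 • (X e : MvPolynomial (Fin N) ℝ)) =
      (∑ e ∈ γᶜ, m e ^ 2 • X e) + ∑ e ∈ γ, m e ^ 2 • X e := (Finset.sum_compl_add_sum γ _).symm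
  rw [secondSymanzikQuot, mul_add, ← mul_assoc, kirchhoffSub_mul_kirchhoffQuot E hconn, kirchhoffSub_mul_twoForestQuot,
    secondSymanzikPolynomial, sum_twoForest_split E γ, kirchhoffPolynomial_split E γ, hm]
  ring

open scoped Classical in
/-- **"where R^{Ξ,UV}_{γ,G}(q,m) has degree > h_γ in the α_e, e ∈ E_γ"**: every monomial of `Ξ_G − Ψ_γ Ξ_{G/γ}` carries at least
`h_γ + 1` variables of `γ` (a 2-forest or tree meeting `γ` in fewer than `rk γ` edges leaves `≥ |γ| − rk γ + 1` edges of `γ` in its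
complement; a `γ`-mass adds one `γ`-variable to a degree-`h_γ` monomial). [cite: Brown2017, Thm 2.7 eq. (XiUVfact), Prop. 2.2 ("strictly greater than deg Ψ_γ = h_γ"); Schultka2018, Proposition 4.11 (1) ("deg_γ(R^Φ_{G|γ}) > deg_γ(Φ_{G|γ}) = h¹_γ + δ^{mm}_γ", here δ = 0)] -/
theorem le_gammaDeg_of_mem_support_uv_remainder (hconn : IsConnectedEdgeList E) (γ : Finset (Fin N))
    (p : Fin (V + 1) → W) (m : Fin N → ℝ) {d : Fin N →₀ ℕ}
    (hd : d ∈ (secondSymanzikPolynomial E p m - kirchhoffSub E γ * secondSymanzikQuot E γ p m).support) :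
    loopNumber E γ + 1 ≤ ∑ e ∈ γ, d e := by
  rw [secondSymanzik_eq_kirchhoffSub_mul_quot_add E hconn γ p m, add_sub_cancel_left] at hd
  have hℓ : loopNumber E γ = γ.card - edgeRank E γ := rfl
  have hrk : edgeRank E γ ≤ γ.card := edgeRank_le_card E γ
  have hsplit : ∀ S : Finset (Fin N), (γ ∩ Sᶜ).card + (S ∩ γ).card = γ.card := fun S => by
    rw [← Finset.sdiff_eq_inter_compl, Finset.inter_comm, Finset.card_sdiff_add_card_inter]
  refine forall_mem_support_add (P := fun d => loopNumber E γ + 1 ≤ ∑ e ∈ γ, d e)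
    (forall_mem_support_add ?_ ?_) ?_ d hd
  · refine forall_mem_support_sum fun F₂ hF₂ => forall_mem_support_smul fun d hd => ?_
    have hlt : (F₂ ∩ γ).card < edgeRank E γ := (Finset.mem_filter.1 hF₂).2.2
    rw [gammaDeg_of_mem_support_prod_X _ γ d hd]
    have := hsplit F₂
    omega
  · refine forall_mem_support_mul (P := fun d => ∑ e ∈ γ, d e = loopNumber E γ) (Q := fun d => ∑ e ∈ γ, d e = 1)
      ?_ ?_ (fun a b ha hb => by rw [gammaDeg_add, ha, hb])
    · refine forall_mem_support_sum fun T hT d hd => ?_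
      have heq : (T ∩ γ).card = edgeRank E γ := (Finset.mem_filter.1 hT).2.2
      rw [gammaDeg_of_mem_support_prod_X _ γ d hd]
      have := hsplit T
      omega
    · refine forall_mem_support_sum fun e he => forall_mem_support_smul fun d hd => ?_
      rw [gammaDeg_of_mem_support_X e γ d hd, if_pos he]
  · refine forall_mem_support_mul (P := fun d => loopNumber E γ + 1 ≤ ∑ e ∈ γ, d e) (Q := fun _ => True)
      ?_ (fun _ _ => trivial) (fun a b ha _ => by rw [gammaDeg_add]; omega)
    refine forall_mem_support_sum fun T hT d hd => ?_
    have hlt : (T ∩ γ).card < edgeRank E γ := (Finset.mem_filter.1 hT).2.2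
    rw [gammaDeg_of_mem_support_prod_X _ γ d hd]
    have := hsplit T
    omega

/-- **… while every monomial of the leading part `Ψ_γ Ξ_{G/γ}` carries EXACTLY `h_γ` variables of `γ`** ("Ψ_G(α') ≡ λ^{h_γ} Ψ_γ Ψ_{G/γ},
Φ_G(α')(q) ≡ λ^{h_γ} Ψ_γ Φ_{G/γ}(q) mod λ^{h_γ+1}" under `α'_e = λ α_e`, `e ∈ E_γ`). [cite: Brown2017, Prop. 2.2 and the scaling form after its proof (arXiv:1512.06409 §2.1); Schultka2018, Proposition 4.11 (1)] -/
theorem gammaDeg_of_mem_support_kirchhoffSub_mul_secondSymanzikQuot {γ : Finset (Fin N)} {p : Fin (V + 1) → W}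
    {m : Fin N → ℝ} {d : Fin N →₀ ℕ} (hd : d ∈ (kirchhoffSub E γ * secondSymanzikQuot E γ p m).support) :
    ∑ e ∈ γ, d e = loopNumber E γ :=
  forall_mem_support_mul (P := fun d => ∑ e ∈ γ, d e = loopNumber E γ) (Q := fun d => ∑ e ∈ γ, d e = 0)
    (R := fun d => ∑ e ∈ γ, d e = loopNumber E γ)
    (fun _ hd => gammaDeg_of_mem_support_kirchhoffSub E hd)
    (fun _ hd => gammaDeg_of_mem_support_secondSymanzikQuot E hd)
    (fun a b ha hb => by rw [gammaDeg_add, ha, hb, add_zero]) d hd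

end UV

/-! ## Part 6 — THE PRINTED DEFINITION OF M.M. IS THE TREE's: `γ` mass-momentum spanning ⟺ `Ξ_{G/γ} = 0` (Brown eq. (2.5); Borinsky §7.1; BMT23 §3.3) -/

section MassMomentum

variable {W : Type*} [NormedAddCommGroup W]

open scoped Classical in
/-- **"m.m. ⟹ Φ_{G/γ} = 0", for ALL conserved momenta**: if `γ` contains every massive edge and joins all momentum-carrying
vertices (the tree's combinatorial `IsMassMomentumSpanning`, Brown Def. 2.6), then `Ξ_{G/γ} = 0` — every 2-forest `γ ∪ T'` of
`G/γ` keeps the external vertices on one side, so its flow is `0` or the (vanishing) total momentum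
(`not_isMomentumSpanning_of_momentumFlow_ne_zero`), and `G/γ` has no massive edge ("γ is momentum-spanning if and only if G/γ is
equivalent to a graph with no external momenta (by momentum conservation)"). No genericity needed in this direction.
[cite: Brown2017, §1.4 after Def. 1.8 and eq. (2.5) (arXiv:1512.06409); Borinsky2020, §7.1 (tropical.tex l.1195); BorinskyMunchTellander2023, §3.3 (main.tex l.733–736)] -/
theorem secondSymanzikQuot_eq_zero_of_isMassMomentumSpanning {γ : Finset (Fin N)} {p : Fin (V + 1) → W}
    (hcons : ∑ v, p v = 0) {m : Fin N → ℝ} (hmm : IsMassMomentumSpanning E p m γ) :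
    secondSymanzikQuot E γ p m = 0 := by
  unfold secondSymanzikQuot
  rw [Finset.sum_eq_zero, zero_add, Finset.sum_eq_zero, mul_zero]
  · intro e he
    have hme : m e = 0 := by
      by_contra h
      exact (Finset.mem_compl.1 he) (hmm.1 e h)
    rw [hme]
    simp
  · intro T' _
    have hflow : momentumFlow E (γ ∪ T') p = 0 := by
      by_contra hne
      exact not_isMomentumSpanning_of_momentumFlow_ne_zero hcons hne (hmm.2.mono Finset.subset_union_left)
    rw [hflow, norm_zero]
    simp

open scoped Classical in
/-- **"With generic momenta, γ is m.m. if and only if Ξ_{G/γ}(q,m) = 0" — the converse direction** (Brown eq. (2.5): "This is a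
direct consequence of lemma 1.13"; it is the DEFINITION of m.m. in Borinsky 2020 §7.1 and BMT23 §3.3, whose equivalence with the
combinatorial one Borinsky states: "Mass-momentum-spanning graphs can also be defined combinatorially as subgraphs that contain all
massive edges and one connected component which connects all vertices with non-zero incoming momentum"). For a connected edge
list with conserved GENERIC Euclidean momenta: if `Ξ_{G/γ} = 0` then `γ` is m.m. Route: were `γ` not m.m., Theorem 32
(`faceValue_secondSymanzikPolynomial_eq_gpSupport`, `z_Φ(γ) = ℓ(γ)`) would give a monomial of `Ξ_G` with exactly `h_γ`
variables of `γ`; but with `Ξ_{G/γ} = 0` the UV factorisation says `Ξ_G = R^{Ξ,UV}`, all of whose monomials carry `> h_γ` of them.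
(Brown's footnote: without genericity the equivalence fails, Example 2.5.) [cite: Brown2017, eq. (2.3)/(2.5), Lemma 1.13, footnote to §2.2 and Example 2.5 (arXiv:1512.06409 §2.2–2.3); Borinsky2020, §7.1 (tropical.tex l.1195) and Theorem 32; BorinskyMunchTellander2023, §3.3 (main.tex l.733–736)] -/
theorem isMassMomentumSpanning_of_secondSymanzikQuot_eq_zero (hconn : IsConnectedEdgeList E) {p : Fin (V + 1) → W}
    (hcons : ∑ v, p v = 0) (hgen : IsGenericMomenta p) {m : Fin N → ℝ} {γ : Finset (Fin N)}
    (h : secondSymanzikQuot E γ p m = 0) : IsMassMomentumSpanning E p m γ := by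
  classical
  by_contra hnot
  by_cases hΦ : secondSymanzikPolynomial E p m = 0
  · obtain ⟨hm, hp⟩ := (secondSymanzikPolynomial_eq_zero_iff hconn hcons hgen m).1 hΦ
    exact hnot ⟨fun e he => absurd (hm e) he, fun u v hu _ => absurd (hp u) hu⟩
  · have h0 := not_isMassMomentumSpanning_empty_of_ne_zero hcons hΦ
    have hfv : faceValue (secondSymanzikPolynomial E p m) (-setIndicator γ) = -(loopNumber E γ : ℝ) := by
      rw [faceValue_secondSymanzikPolynomial_eq_gpSupport hconn hcons hgen hΦ]
      have h1 := lovaszExt_setIndicator (fun A => -zSecondSymanzik E p m A) γ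
      simp only [lovaszExt, neg_neg] at h1
      rw [zSecondSymanzik_empty h0, zSecondSymanzik_apply, if_neg hnot, add_zero, neg_zero, sub_zero] at h1
      exact h1
    obtain ⟨d, hd, hdy⟩ := exists_pairing_eq_faceValue hΦ (-setIndicator γ)
    rw [hfv, pairing_neg_setIndicator, neg_inj, Nat.cast_inj] at hdy
    have hR : d ∈ (secondSymanzikPolynomial E p m - kirchhoffSub E γ * secondSymanzikQuot E γ p m).support := by
      rw [h, mul_zero, sub_zero]
      exact hd
    have := le_gammaDeg_of_mem_support_uv_remainder E hconn γ p m hR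
    omega

/-- **Borinsky's / BMT23's definition of m.m. ⟺ the combinatorial one (Brown Def. 2.6)**, for a connected edge list with conserved
generic Euclidean momenta: `γ` is mass-momentum spanning iff `Ξ_{G/γ}(q,m) = 0`. [cite: Borinsky2020, §7.1 (tropical.tex l.1195); BorinskyMunchTellander2023, §3.3 (main.tex l.733–736); Brown2017, eq. (2.5) and Def. 2.6] -/
theorem isMassMomentumSpanning_iff_secondSymanzikQuot_eq_zero (hconn : IsConnectedEdgeList E) {p : Fin (V + 1) → W}
    (hcons : ∑ v, p v = 0) (hgen : IsGenericMomenta p) (m : Fin N → ℝ) (γ : Finset (Fin N)) :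
    IsMassMomentumSpanning E p m γ ↔ secondSymanzikQuot E γ p m = 0 :=
  ⟨secondSymanzikQuot_eq_zero_of_isMassMomentumSpanning E hcons,
    isMassMomentumSpanning_of_secondSymanzikQuot_eq_zero E hconn hcons hgen⟩

end MassMomentum

/-! ## Part 7 — the lowest-order part in the `γ`-variables IS Borinsky's truncation to the face exposed by `−1_γ`: `Ξ_G|_{F_{−1_γ}} = Ψ_γ · Ξ_{G/γ}` whenever `Ξ_{G/γ} ≠ 0`, i.e. (generic momenta) whenever `γ` is not m.m. -/

section Truncation

variable {W : Type*} [NormedAddCommGroup W]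

open scoped Classical in
/-- **Leading part = truncation.** If `p = q + r` with `q ≠ 0`, every monomial of `q` pairing to `c` with `y` and every monomial of
`r` pairing to less, then the face value of `NP_p` in direction `y` is `c` and Borinsky's truncation `p_{F_y}` (Definition 1) is
`q`. (The dictionary between "lowest-order part in the variables of γ, remainder of higher degree" and "initial form on the face of
the Newton polytope exposed by −1_γ".) [cite: Borinsky2020, Definition 1 (tropical.tex l.302–306) with l.291 (faces F_y); Brown2017, Prop. 2.2 (scaling form α'_e = λ α_e)] -/
theorem faceValue_eq_and_trunc_eq_of_eq_add {p q r : MvPolynomial (Fin N) ℝ} {y : Fin N → ℝ} {c : ℝ}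
    (hpqr : p = q + r) (hq0 : q ≠ 0) (hq : ∀ d ∈ q.support, pairing y d = c)
    (hr : ∀ d ∈ r.support, pairing y d < c) : faceValue p y = c ∧ trunc p y = q := by
  have hqr : ∀ d ∈ q.support, d ∉ r.support := fun d hd hd' => by
    have := hr d hd'
    rw [hq d hd] at this
    exact lt_irrefl _ this
  have hcoeff : ∀ d, coeff d p = coeff d q + coeff d r := fun d => by rw [hpqr, coeff_add]
  have hsq : ∀ d ∈ q.support, d ∈ p.support ∧ coeff d p = coeff d q := fun d hd => by
    have h0 : coeff d r = 0 := notMem_support_iff.1 (hqr d hd)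
    rw [mem_support_iff, hcoeff d, h0, add_zero]
    exact ⟨mem_support_iff.1 hd, rfl⟩
  have hsr : ∀ d ∈ p.support, d ∉ q.support → d ∈ r.support := fun d hd hdq => by
    have h0 : coeff d q = 0 := notMem_support_iff.1 hdq
    rw [mem_support_iff, hcoeff d, h0, zero_add] at hd
    exact mem_support_iff.2 hd
  obtain ⟨d₀, hd₀⟩ := support_nonempty.2 hq0
  have hp0 : p ≠ 0 := support_nonempty.1 ⟨d₀, (hsq d₀ hd₀).1⟩
  have hfv : faceValue p y = c := by
    apply le_antisymm
    · obtain ⟨d₁, hd₁, h₁⟩ := exists_pairing_eq_faceValue hp0 y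
      rw [← h₁]
      by_cases hd₁q : d₁ ∈ q.support
      · exact (hq d₁ hd₁q).le
      · exact (hr d₁ (hsr d₁ hd₁ hd₁q)).le
    · rw [← hq d₀ hd₀]
      exact pairing_le_faceValue (hsq d₀ hd₀).1 y
  refine ⟨hfv, ?_⟩
  unfold trunc
  rw [hfv]
  have hfilter : p.support.filter (fun d => pairing y d = c) = q.support := by
    ext d
    rw [Finset.mem_filter]
    constructor
    · rintro ⟨hdp, hdc⟩
      by_contra hdq
      have := hr d (hsr d hdp hdq)
      rw [hdc] at this
      exact lt_irrefl _ this
    · intro hdq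
      exact ⟨(hsq d hdq).1, hq d hdq⟩
  rw [hfilter, Finset.sum_congr rfl fun d hd => by rw [(hsq d hd).2]]
  exact (as_sum q).symm

open scoped Classical in
/-- **`Ξ_G|_{F_{−1_γ}} = Ψ_γ · Ξ_{G/γ}` and `deg_γ`-minimum `= h_γ`, whenever `Ξ_{G/γ} ≠ 0`** — the initial form of the second
Symanzik polynomial on the face of `NP_{Ξ_G}` exposed by the UV weight `−1_γ` (Borinsky's truncation, Definition 1; the face the
Hepp-sector / forest-formula `K_γ`-operation evaluates on) is the PRODUCT `Ψ_γ Ξ_{G/γ}` (Schultka Cor. 4.12: "The face of P_G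
corresponding to the weight vector e^γ is F_{e^γ}P_G = P_γ × P_{G/γ}"), for every connected edge list and all momenta / masses
with `Ξ_{G/γ} ≠ 0`. [cite: Brown2017, Prop. 2.2 / Thm 2.7 eq. (XiUVfact) (arXiv:1512.06409 §2); Schultka2018, Proposition 4.11 (1) and Corollary 4.12 (toricfeynman.tex l.2236–2304); Borinsky2020, Definition 1 (tropical.tex l.302–306)] -/
theorem faceValue_and_trunc_secondSymanzik_neg_setIndicator (hconn : IsConnectedEdgeList E) {γ : Finset (Fin N)}
    {p : Fin (V + 1) → W} {m : Fin N → ℝ} (hq : secondSymanzikQuot E γ p m ≠ 0) :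
    faceValue (secondSymanzikPolynomial E p m) (-setIndicator γ) = -(loopNumber E γ : ℝ) ∧
      trunc (secondSymanzikPolynomial E p m) (-setIndicator γ) = kirchhoffSub E γ * secondSymanzikQuot E γ p m := by
  refine faceValue_eq_and_trunc_eq_of_eq_add
    (r := secondSymanzikPolynomial E p m - kirchhoffSub E γ * secondSymanzikQuot E γ p m)
    (add_sub_cancel _ _).symm (mul_ne_zero (kirchhoffSub_ne_zero E γ) hq) (fun d hd => ?_) (fun d hd => ?_)
  · rw [pairing_neg_setIndicator, gammaDeg_of_mem_support_kirchhoffSub_mul_secondSymanzikQuot E hd]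
  · rw [pairing_neg_setIndicator, neg_lt_neg_iff]
    exact_mod_cast Nat.lt_of_succ_le (le_gammaDeg_of_mem_support_uv_remainder E hconn γ p m hd)

open scoped Classical in
/-- **The UV face of `NP_{Φ_G}` for a non-m.m. subgraph is a product face**: for a connected edge list with conserved, generic
Euclidean momenta and `γ` NOT mass-momentum spanning, `Φ_G|_{F_{−1_γ}} = Ψ_γ · Ξ_{G/γ}` — Borinsky's proof of Theorem 32 ("The form
of the boolean functions z_Ψ and z_Φ follows directly from the factorization laws"), the branch `z_Φ(γ) = ℓ(γ)`.
[cite: Borinsky2020, Theorem 32 and its proof (tropical.tex l.1197–1219); Brown2017, Prop. 2.2 / Thm 2.7; Schultka2018, Corollary 4.12] -/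
theorem trunc_secondSymanzik_neg_setIndicator_of_not_isMassMomentumSpanning (hconn : IsConnectedEdgeList E)
    {p : Fin (V + 1) → W} (hcons : ∑ v, p v = 0) (hgen : IsGenericMomenta p) {m : Fin N → ℝ} {γ : Finset (Fin N)}
    (hnot : ¬ IsMassMomentumSpanning E p m γ) :
    trunc (secondSymanzikPolynomial E p m) (-setIndicator γ) = kirchhoffSub E γ * secondSymanzikQuot E γ p m :=
  (faceValue_and_trunc_secondSymanzik_neg_setIndicator E hconn fun h =>
    hnot (isMassMomentumSpanning_of_secondSymanzikQuot_eq_zero E hconn hcons hgen h)).2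

end Truncation

/-! ## Part 8 — THE IR FACTORISATION `Ξ_G(q,m) = Ξ_γ(q,m) · Ψ_{G/γ} + R^{Ξ,IR}_{γ,G}(q,m)`, `deg_γ R > h_γ + 1`, for `γ` mass-momentum spanning (Brown Prop. 2.4 / Thm 2.7 eq. (XiIRfact); Schultka Prop. 4.11 (1),(4),(5)) -/

section IRDefinition

variable {W : Type*} [NormedAddCommGroup W]

open scoped Classical in
/-- **`Ξ_γ(q,m) = Φ_γ(q) + (Σ_{e∈γ} m_e² x_e) Ψ_γ`, the second Symanzik polynomial of the edge SUBGRAPH `γ` WITH THE KINEMATICS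
OF `G`** ("the Feynman graph (V_γ, E_γ, E^ext_γ) inherits all external momenta of G if it is momentum-spanning"; for
`γ = γ_0 ∪ γ_1 ∪ ⋯` with the external vertices in `γ_0`: "Φ_γ(q) = Φ_{γ_0}(q) Π_{i≥1} Ψ_{γ_i}"), in matroid form, variables of
`γ`: a spanning 2-forest of the subgraph `γ` (one more component than `γ`) is an independent `F' ⊆ γ` with `|F'| = rk γ − 1`;
the momentum entering its component through the vertex `a` is `Σ_{v ~_{F'} a} p_v`. Read from a vertex `a` of the momentum
component `γ_0` this is Brown's `q^{F'_1}` up to sign when `F'` splits `γ_0`, and the (vanishing, by conservation) total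
momentum when `F'` splits some `γ_i`, `i ≥ 1` — so the sum IS `Φ_{γ_0} Π_{i≥1} Ψ_{γ_i}` plus terms with coefficient `0`; the
theorems below use it only under "`a` reaches every momentum-carrying vertex inside `γ`". Masses: those of the edges of `γ`.
[cite: Brown2017, §1.4 eq. (Edgesubgraphdefn) and Prop. 2.4 with its proof (arXiv:1512.06409 §1.4, §2.2), Thm 2.7 eq. (XiIRfact); Schultka2018, §4 before Proposition 4.11 ("For an m.m. subgraph γ, we set V^ext_γ = V^ext_G and E^M_γ = E^M_G", toricfeynman.tex l.2209–2226)] -/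
def secondSymanzikSub (γ : Finset (Fin N)) (p : Fin (V + 1) → W) (m : Fin N → ℝ) (a : Fin (V + 1)) :
    MvPolynomial (Fin N) ℝ :=
  (∑ F' ∈ γ.powerset.filter (fun F' : Finset (Fin N) => edgeRank E F' = F'.card ∧ F'.card + 1 = edgeRank E γ),
      ‖∑ v ∈ univ.filter (fun v => (edgeGraph E F').Reachable a v), p v‖ ^ 2 • ∏ e ∈ γ \ F', X e) +
    kirchhoffSub E γ * ∑ e ∈ γ, m e ^ 2 • X e

/-- **Every monomial of `Ξ_γ` carries exactly `h_γ + 1` variables of `γ`** ("deg Φ_γ(q) = h_γ + 1": a 2-forest `F'` of `γ`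
leaves `|γ| − rk γ + 1` edges, a `γ`-mass adds one variable to a degree-`h_γ` monomial of `Ψ_γ`). [cite: Brown2017, Prop. 2.4 ("strictly greater than deg Φ_γ(q) = h_γ + 1"); Schultka2018, Proposition 4.11 (1) (deg_γ(Φ_{G|γ}) = h¹_γ + δ^{mm}_γ)] -/
theorem gammaDeg_of_mem_support_secondSymanzikSub {γ : Finset (Fin N)} {p : Fin (V + 1) → W} {m : Fin N → ℝ}
    {a : Fin (V + 1)} {d : Fin N →₀ ℕ} (hd : d ∈ (secondSymanzikSub E γ p m a).support) :
    ∑ e ∈ γ, d e = loopNumber E γ + 1 := by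
  classical
  unfold secondSymanzikSub at hd
  have hℓ : loopNumber E γ = γ.card - edgeRank E γ := rfl
  have hrk : edgeRank E γ ≤ γ.card := edgeRank_le_card E γ
  refine forall_mem_support_add (P := fun d => ∑ e ∈ γ, d e = loopNumber E γ + 1) ?_ ?_ d hd
  · refine forall_mem_support_sum fun F' hF' => forall_mem_support_smul fun d hd => ?_
    obtain ⟨hF'γ, -, hcard⟩ := Finset.mem_filter.1 hF'
    rw [Finset.mem_powerset] at hF'γ
    rw [gammaDeg_of_mem_support_prod_X _ γ d hd, Finset.inter_eq_right.2 Finset.sdiff_subset,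
      Finset.card_sdiff_of_subset hF'γ]
    have := Finset.card_le_card hF'γ
    omega
  · exact forall_mem_support_mul (P := fun d => ∑ e ∈ γ, d e = loopNumber E γ) (Q := fun d => ∑ e ∈ γ, d e = 1)
      (R := fun d => ∑ e ∈ γ, d e = loopNumber E γ + 1)
      (fun _ hd => gammaDeg_of_mem_support_kirchhoffSub E hd)
      (forall_mem_support_sum fun e he => forall_mem_support_smul fun d hd => by
        rw [gammaDeg_of_mem_support_X e γ d hd, if_pos he])
      (fun a b ha hb => by rw [gammaDeg_add, ha, hb])

/-- For an m.m. `γ` and a vertex `a` with non-zero momentum, `a` reaches every momentum-carrying vertex inside `γ` — the hypothesis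
under which the IR statements below read `Ξ_γ` from `a` ("all external vertices are contained in the component γ_0").
[cite: Brown2017, Def. 1.8 / Def. 2.6; Schultka2018, Proposition 4.11 (4)] -/
theorem IsMassMomentumSpanning.reachable_of_ne_zero {γ : Finset (Fin N)} {p : Fin (V + 1) → W} {m : Fin N → ℝ}
    (hmm : IsMassMomentumSpanning E p m γ) {a : Fin (V + 1)} (hpa : p a ≠ 0) :
    ∀ v, p v ≠ 0 → (edgeGraph E γ).Reachable a v :=
  fun v hv => hmm.2 a v hpa hv

end IRDefinition

section IRFlows

variable {W : Type*} [NormedAddCommGroup W]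

/-- **A 2-forest meeting the momentum-spanning `γ` in a maximal forest carries no flow** (Brown, proof of Prop. 2.4: "For such
a 2-tree, T ∩ γ' cannot be connected because each component T_i intersects γ' non-trivially (otherwise … q^{T_i} = 0 because γ'
is momentum-spanning)"): if `S` is a forest with `|S ∩ γ| = rk γ` then `S ∩ γ` spans `γ`, so all momentum-carrying vertices lie
in one component of `S` and `p(S) = 0` by conservation. [cite: Brown2017, Prop. 2.4 (proof, arXiv:1512.06409 §2.2)] -/
theorem momentumFlow_eq_zero_of_card_inter_eq {γ S : Finset (Fin N)} {p : Fin (V + 1) → W} (hcons : ∑ v, p v = 0)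
    {a : Fin (V + 1)} (ha : ∀ v, p v ≠ 0 → (edgeGraph E γ).Reachable a v) (hS : edgeRank E S = S.card)
    (hcard : (S ∩ γ).card = edgeRank E γ) : momentumFlow E S p = 0 := by
  have hrk : edgeRank E (S ∩ γ) = edgeRank E γ := by
    rw [edgeRank_eq_card_of_subset hS Finset.inter_subset_left, hcard]
  have hms : IsMomentumSpanning E p S := fun u v hu hv =>
    (((reachable_iff_reachable_of_subset_of_edgeRank_eq E Finset.inter_subset_right hrk a u).2 (ha u hu)).mono
      (edgeGraph_mono Finset.inter_subset_left)).symm.trans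
    (((reachable_iff_reachable_of_subset_of_edgeRank_eq E Finset.inter_subset_right hrk a v).2 (ha v hv)).mono
      (edgeGraph_mono Finset.inter_subset_left))
  by_contra h
  exact not_isMomentumSpanning_of_momentumFlow_ne_zero hcons h hms

/-- **A 2-forest one edge short of spanning `γ` whose outside part does NOT span `G/γ` carries no flow either**: then `γ ∪ (S ∖ γ)`
has the same two components as `S`, one of which contains the whole momentum component of `γ` (these are the 2-forests that split
a component `γ_i`, `i ≥ 1`, without external momenta, or whose image in `G/γ` is not a tree — absent from "monomials in Φ_G(q)
… 2-trees T such that (q^{T_1})² ≠ 0"). [cite: Brown2017, Prop. 2.4 (proof: the classes C_1, C_2 among 2-trees with (q^{T_1})² ≠ 0)] -/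
theorem momentumFlow_eq_zero_of_not_contract_indep {γ S : Finset (Fin N)} {p : Fin (V + 1) → W} (hcons : ∑ v, p v = 0)
    {a : Fin (V + 1)} (ha : ∀ v, p v ≠ 0 → (edgeGraph E γ).Reachable a v) (hS : IsSpanningTwoForest E S)
    (hcard : (S ∩ γ).card + 1 = edgeRank E γ)
    (hdep : ¬ ((cycleMatroid E) ／ (γ : Set (Fin N))).Indep ((S \ γ : Finset (Fin N)) : Set (Fin N))) :
    momentumFlow E S p = 0 := by
  -- extend the forest `S ∩ γ` of `γ` to a maximal one, `F`
  have hind : (cycleMatroid E).Indep ((S ∩ γ : Finset (Fin N)) : Set (Fin N)) :=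
    (indep_cycleMatroid_iff_edgeRank E _).2 (edgeRank_eq_card_of_subset hS.2 Finset.inter_subset_left)
  obtain ⟨F₀, hF₀, -⟩ := hind.subset_isBasis_of_subset (Finset.coe_subset.2 Finset.inter_subset_right)
  obtain ⟨F, rfl⟩ : ∃ F : Finset (Fin N), (F : Set (Fin N)) = F₀ := ⟨(Set.toFinite F₀).toFinset, by simp⟩
  have hFγ := (isBasis_cycleMatroid_iff E F γ).1 hF₀
  have hdisj : Disjoint (γ : Set (Fin N)) ((S \ γ : Finset (Fin N)) : Set (Fin N)) := by
    rw [Finset.disjoint_coe]; exact Finset.disjoint_sdiff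
  rw [hF₀.contract_indep_iff_of_disjoint hdisj, ← Finset.coe_union, indep_cycleMatroid_iff_edgeRank] at hdep
  -- the rank of `γ ∪ (S ∖ γ)` is that of `S`
  have hB : edgeRank E (γ ∪ S \ γ) = edgeRank E S := by
    have h1 : edgeRank E S ≤ edgeRank E (γ ∪ S \ γ) :=
      edgeRank_mono fun e he => by
        by_cases heγ : e ∈ γ
        · exact Finset.mem_union_left _ heγ
        · exact Finset.mem_union_right _ (Finset.mem_sdiff.2 ⟨he, heγ⟩)
    have h2 : edgeRank E (γ ∪ S \ γ) = edgeRank E (S \ γ ∪ F) := by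
      rw [Finset.union_comm (S \ γ) F, edgeRank_union_eq_of_isBasis E hF₀]
    have h3 : edgeRank E (S \ γ ∪ F) ≤ (S \ γ ∪ F).card := edgeRank_le_card E _
    have h4 : (S \ γ ∪ F).card = (S \ γ).card + F.card :=
      Finset.card_union_of_disjoint (Finset.disjoint_sdiff.symm.mono_right hFγ.1)
    have h5 := Finset.card_sdiff_add_card_inter S γ
    have h6 := hS.1
    have h7 := hS.2
    have h8 := hFγ.2.2
    omega
  have hsub : S ⊆ γ ∪ S \ γ := fun e he => by
    by_cases heγ : e ∈ γ
    · exact Finset.mem_union_left _ heγ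
    · exact Finset.mem_union_right _ (Finset.mem_sdiff.2 ⟨he, heγ⟩)
  have hreach : ∀ v, p v ≠ 0 → (edgeGraph E S).Reachable a v := fun v hv =>
    (reachable_iff_reachable_of_subset_of_edgeRank_eq E hsub hB.symm a v).2
      ((ha v hv).mono (edgeGraph_mono Finset.subset_union_left))
  have hms : IsMomentumSpanning E p S := fun u v hu hv => (hreach u hu).symm.trans (hreach v hv)
  by_contra h
  exact not_isMomentumSpanning_of_momentumFlow_ne_zero hcons h hms

open scoped Classical in
/-- **The flow of a class-`C_1` 2-forest is the momentum entering one half of `γ_0`** (Brown, proof of Prop. 2.4: the bijection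
`T ↦ (T ∩ γ', (T ∪ γ)/γ, T ∩ γ_i)` matches the monomial `(q^{T_1})² Π α` of `Φ_G` with that of `Φ_{γ'} Π Ψ_{γ_i} · Ψ_{G/γ}`): if
the spanning 2-forest `S` meets `γ` in a forest `S ∩ γ` one edge short of maximal and `S ∖ γ` spans `G/γ`, then inside the
momentum component of `γ` the components of `S` are those of `S ∩ γ` (a strict-submodularity count,
`edgeRank_union_add_inter_add_one_le`), so `‖p(S)‖ = ‖Σ_{v ~_{S∩γ} a} p_v‖` — independently of `S ∖ γ`.
[cite: Brown2017, Prop. 2.4 (proof, arXiv:1512.06409 §2.2); Schultka2018, Proposition 4.11 proof sketch ("𝒯̃²_γ … F splits γ_0 into two connected components", toricfeynman.tex l.2294–2304)] -/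
theorem norm_momentumFlow_eq_of_contract_indep {γ S : Finset (Fin N)} {p : Fin (V + 1) → W} (hcons : ∑ v, p v = 0)
    {a : Fin (V + 1)} (ha : ∀ v, p v ≠ 0 → (edgeGraph E γ).Reachable a v) (hS : IsSpanningTwoForest E S)
    (hcard : (S ∩ γ).card + 1 = edgeRank E γ)
    (hind : ((cycleMatroid E) ／ (γ : Set (Fin N))).Indep ((S \ γ : Finset (Fin N)) : Set (Fin N))) :
    ‖momentumFlow E S p‖ = ‖∑ v ∈ univ.filter (fun v => (edgeGraph E (S ∩ γ)).Reachable a v), p v‖ := by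
  obtain ⟨F, hF⟩ := exists_isBasis_cycleMatroid E γ
  have hFγ := (isBasis_cycleMatroid_iff E F γ).1 hF
  have hdisj : Disjoint (γ : Set (Fin N)) ((S \ γ : Finset (Fin N)) : Set (Fin N)) := by
    rw [Finset.disjoint_coe]; exact Finset.disjoint_sdiff
  rw [hF.contract_indep_iff_of_disjoint hdisj, ← Finset.coe_union, indep_cycleMatroid_iff_edgeRank] at hind
  -- `rk(S ∪ γ) = V`
  have hSγ : edgeRank E (S ∪ γ) = V := by
    have h1 : S ∪ γ = γ ∪ S \ γ := by
      ext e
      simp only [Finset.mem_union, Finset.mem_sdiff]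
      tauto
    have h4 : (S \ γ ∪ F).card = (S \ γ).card + F.card :=
      Finset.card_union_of_disjoint (Finset.disjoint_sdiff.symm.mono_right hFγ.1)
    rw [h1, ← edgeRank_union_eq_of_isBasis E hF (S \ γ), Finset.union_comm F (S \ γ), hind, h4, hFγ.2.2]
    have h5 := Finset.card_sdiff_add_card_inter S γ
    have h6 := hS.1
    omega
  -- (K): inside the momentum component, `S`-reachability from `a` is `S ∩ γ`-reachability
  have hK : ∀ u, (edgeGraph E γ).Reachable a u →
      ((edgeGraph E S).Reachable a u ↔ (edgeGraph E (S ∩ γ)).Reachable a u) := by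
    intro u hγ
    refine ⟨fun hSu => ?_, fun h => h.mono (edgeGraph_mono Finset.inter_subset_left)⟩
    by_contra hnot
    have hstrict := edgeRank_union_add_inter_add_one_le E hSu hγ hnot
    rw [hSγ, edgeRank_eq_card_of_subset hS.2 Finset.inter_subset_left, hS.2] at hstrict
    have h6 := hS.1
    omega
  -- the momentum-carrying vertices on `a`'s side, in `S` and in `S ∩ γ`, coincide
  have hfilter : univ.filter (fun v => (edgeGraph E S).Reachable a v ∧ p v ≠ 0) =
      univ.filter (fun v => (edgeGraph E (S ∩ γ)).Reachable a v ∧ p v ≠ 0) := by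
    refine Finset.filter_congr fun v _ => ⟨fun h => ⟨(hK v (ha v h.2)).1 h.1, h.2⟩,
      fun h => ⟨(hK v (ha v h.2)).2 h.1, h.2⟩⟩
  have hsumA : ∑ v ∈ univ.filter (fun v => (edgeGraph E S).Reachable a v), p v =
      ∑ v ∈ univ.filter (fun v => (edgeGraph E (S ∩ γ)).Reachable a v), p v := by
    rw [← Finset.sum_filter_ne_zero (univ.filter fun v => (edgeGraph E S).Reachable a v), Finset.filter_filter, hfilter,
      ← Finset.filter_filter, Finset.sum_filter_ne_zero]
  by_cases h0 : (edgeGraph E S).Reachable 0 a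
  · -- the root lies on `a`'s side
    have h1 : momentumFlow E S p = ∑ v ∈ univ.filter (fun v => (edgeGraph E S).Reachable a v), p v := by
      unfold momentumFlow
      exact Finset.sum_congr (Finset.filter_congr fun v _ => ⟨fun h => h0.symm.trans h, fun h => h0.trans h⟩)
        fun _ _ => rfl
    rw [h1, hsumA]
  · -- the root lies on the other side: the flow is minus the momentum of `a`'s side
    have h1 : momentumFlow E S p = -∑ v ∈ univ.filter (fun v => (edgeGraph E S).Reachable a v), p v := by
      have h2 := momentumFlow_add_sum_filter_not S p (E := E)
      rw [hcons, add_eq_zero_iff_eq_neg] at h2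
      rw [h2, neg_inj]
      exact Finset.sum_congr (Finset.filter_congr fun v _ =>
        (not_congr (hS.reachable_iff_not_reachable h0 v)).trans not_not) fun _ _ => rfl
    rw [h1, norm_neg, hsumA]

end IRFlows

section IRPieces

variable {W : Type*} [NormedAddCommGroup W]

open scoped Classical in
/-- **Brown's bijection for the class `C_1`** (proof of Prop. 2.4: "There is a bijection from the first set C_1 to {Spanning
2-trees in γ'} × {Spanning trees in G/γ} × Π_i {Spanning trees in γ_i}. It is given by the map T ↦ (T ∩ γ', (T ∪ γ)/γ, T ∩ γ_1,
…, T ∩ γ_n)"), in matroid form: `S ↦ (S ∩ γ, S ∖ γ)` from the spanning 2-forests with `|S ∩ γ| = rk γ − 1` and `S ∖ γ` spanning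
`G/γ` onto (2-forests `F'` of the subgraph `γ`) × (bases of `M(G)/γ`); as a re-indexing of sums. [cite: Brown2017, Prop. 2.4 (proof, arXiv:1512.06409 §2.2); Schultka2018, Proposition 4.11 proof sketch (toricfeynman.tex l.2294–2304)] -/
theorem sum_twoForests_submax_eq_sum_sum (hconn : IsConnectedEdgeList E) (γ : Finset (Fin N)) {β : Type*} [AddCommMonoid β]
    (g : Finset (Fin N) → Finset (Fin N) → β) :
    ∑ S ∈ univ.filter (fun S : Finset (Fin N) => IsSpanningTwoForest E S ∧ (S ∩ γ).card + 1 = edgeRank E γ ∧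
        ((cycleMatroid E) ／ (↑γ : Set (Fin N))).Indep ((S \ γ : Finset (Fin N)) : Set (Fin N))), g (S ∩ γ) (S \ γ) =
      ∑ F' ∈ γ.powerset.filter (fun F' : Finset (Fin N) => edgeRank E F' = F'.card ∧ F'.card + 1 = edgeRank E γ),
        ∑ T' ∈ γᶜ.powerset.filter
            (fun T' : Finset (Fin N) => ((cycleMatroid E) ／ (↑γ : Set (Fin N))).IsBase (↑T' : Set (Fin N))),
          g F' T' := by
  rw [← Finset.sum_product']
  symm
  refine Finset.sum_nbij' (fun q : Finset (Fin N) × Finset (Fin N) => q.1 ∪ q.2)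
    (fun S : Finset (Fin N) => (S ∩ γ, S \ γ)) ?_ ?_ ?_ ?_ ?_
  · rintro ⟨F', T'⟩ hq
    show F' ∪ T' ∈ _
    rw [Finset.mem_product] at hq
    obtain ⟨hF', hT'⟩ := hq
    rw [Finset.mem_filter, Finset.mem_powerset] at hF' hT'
    have hF'γ : F' ⊆ γ := hF'.1
    have hT'c : T' ⊆ γᶜ := hT'.1
    have hdisj : Disjoint T' γ := Finset.disjoint_left.2 fun e he heγ => (Finset.mem_compl.1 (hT'c he)) heγ
    have hbase := (contract_isBase_iff_indep_card E hconn hT'c).1 hT'.2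
    -- extend `F'` to a basis `F` of `γ`; `T' ∪ F` is independent, hence so is `T' ∪ F'`
    have hF'ind : (cycleMatroid E).Indep (F' : Set (Fin N)) := (indep_cycleMatroid_iff_edgeRank E F').2 hF'.2.1
    obtain ⟨F₀, hF₀, hF'F₀⟩ := hF'ind.subset_isBasis_of_subset (Finset.coe_subset.2 hF'γ)
    have hdisj' : Disjoint (γ : Set (Fin N)) (T' : Set (Fin N)) := by
      rw [Finset.disjoint_coe]; exact hdisj.symm
    have hind : (cycleMatroid E).Indep (((F' ∪ T' : Finset (Fin N))) : Set (Fin N)) := by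
      have h := (hF₀.contract_indep_iff_of_disjoint hdisj').1 hbase.1
      rw [Finset.coe_union]
      exact h.subset (Set.union_subset (hF'F₀.trans Set.subset_union_right) Set.subset_union_left)
    rw [indep_cycleMatroid_iff_edgeRank] at hind
    have hcard : (F' ∪ T').card = F'.card + T'.card := Finset.card_union_of_disjoint (hdisj.symm.mono_left hF'γ)
    have h1 : (F' ∪ T') ∩ γ = F' := by
      rw [Finset.union_inter_distrib_right, Finset.inter_eq_left.2 hF'γ, Finset.disjoint_iff_inter_eq_empty.1 hdisj,
        Finset.union_empty]
    have h2 : (F' ∪ T') \ γ = T' := by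
      rw [Finset.union_sdiff_distrib, Finset.sdiff_eq_empty_iff_subset.2 hF'γ, Finset.empty_union]
      exact sdiff_eq_left.2 hdisj
    have hk : T'.card + 1 + edgeRank E γ = V + 1 := hbase.2
    have hF'c : F'.card + 1 = edgeRank E γ := hF'.2.2
    rw [Finset.mem_filter, h1, h2]
    exact ⟨Finset.mem_univ _, ⟨by rw [hcard]; omega, hind⟩, hF'c, hbase.1⟩
  · intro S hS
    simp only [Finset.mem_filter, Finset.mem_univ, true_and] at hS
    obtain ⟨hS1, hS2, hS3⟩ := hS
    have hcard := Finset.card_sdiff_add_card_inter S γ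
    have hS4 := hS1.1
    rw [Finset.mem_product]
    show S ∩ γ ∈ _ ∧ S \ γ ∈ _
    rw [Finset.mem_filter, Finset.mem_powerset, Finset.mem_filter, Finset.mem_powerset,
      contract_isBase_iff_indep_card E hconn (fun e he => Finset.mem_compl.2 (Finset.mem_sdiff.1 he).2)]
    exact ⟨⟨Finset.inter_subset_right, edgeRank_eq_card_of_subset hS1.2 Finset.inter_subset_left, hS2⟩,
      fun e he => Finset.mem_compl.2 (Finset.mem_sdiff.1 he).2, hS3, by omega⟩
  · rintro ⟨F', T'⟩ hq
    rw [Finset.mem_product] at hq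
    obtain ⟨hF', hT'⟩ := hq
    rw [Finset.mem_filter, Finset.mem_powerset] at hF' hT'
    have hF'γ : F' ⊆ γ := hF'.1
    have hT'c : T' ⊆ γᶜ := hT'.1
    have hdisj : Disjoint T' γ := Finset.disjoint_left.2 fun e he heγ => (Finset.mem_compl.1 (hT'c he)) heγ
    ext1
    · show (F' ∪ T') ∩ γ = F'
      rw [Finset.union_inter_distrib_right, Finset.inter_eq_left.2 hF'γ, Finset.disjoint_iff_inter_eq_empty.1 hdisj,
        Finset.union_empty]
    · show (F' ∪ T') \ γ = T'
      rw [Finset.union_sdiff_distrib, Finset.sdiff_eq_empty_iff_subset.2 hF'γ, Finset.empty_union]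
      exact sdiff_eq_left.2 hdisj
  · intro S _
    show S ∩ γ ∪ S \ γ = S
    rw [Finset.union_comm, Finset.sdiff_union_inter]
  · rintro ⟨F', T'⟩ hq
    rw [Finset.mem_product] at hq
    obtain ⟨hF', hT'⟩ := hq
    rw [Finset.mem_filter, Finset.mem_powerset] at hF' hT'
    have hF'γ : F' ⊆ γ := hF'.1
    have hT'c : T' ⊆ γᶜ := hT'.1
    have hdisj : Disjoint T' γ := Finset.disjoint_left.2 fun e he heγ => (Finset.mem_compl.1 (hT'c he)) heγ
    show g F' T' = g ((F' ∪ T') ∩ γ) ((F' ∪ T') \ γ)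
    rw [Finset.union_inter_distrib_right, Finset.inter_eq_left.2 hF'γ, Finset.disjoint_iff_inter_eq_empty.1 hdisj,
      Finset.union_empty, Finset.union_sdiff_distrib, Finset.sdiff_eq_empty_iff_subset.2 hF'γ, Finset.empty_union,
      sdiff_eq_left.2 hdisj]

open scoped Classical in
/-- **`Φ_γ(q) · Ψ_{G/γ} = Σ_{T ∈ C_1} (q^{T_1})² Π_{e∉T} x_e`** — the 2-forest part of `Ξ_γ` (kinematics of `G`, read from `a`)
times `Ψ_{G/γ}` is the sum over the class-`C_1` 2-forests of `G` with THEIR OWN flows ("This gives a one-to-one correspondence between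
the set C_1 and monomials in Φ_γ(q) = (Φ_{γ'}(q) Π_i Ψ_{γ_i}) Ψ_{G/γ}"), for conserved momenta all of whose carriers `a` reaches
inside `γ`. [cite: Brown2017, Prop. 2.4 (proof, arXiv:1512.06409 §2.2); Schultka2018, Proposition 4.11 proof sketch (toricfeynman.tex l.2294–2304)] -/
theorem twoForestSub_mul_kirchhoffQuot (hconn : IsConnectedEdgeList E) (γ : Finset (Fin N)) {p : Fin (V + 1) → W}
    (hcons : ∑ v, p v = 0) {a : Fin (V + 1)} (ha : ∀ v, p v ≠ 0 → (edgeGraph E γ).Reachable a v) :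
    (∑ F' ∈ γ.powerset.filter (fun F' : Finset (Fin N) => edgeRank E F' = F'.card ∧ F'.card + 1 = edgeRank E γ),
        ‖∑ v ∈ univ.filter (fun v => (edgeGraph E F').Reachable a v), p v‖ ^ 2 •
          ∏ e ∈ γ \ F', (X e : MvPolynomial (Fin N) ℝ)) * kirchhoffQuot E γ =
      ∑ S ∈ univ.filter (fun S : Finset (Fin N) => IsSpanningTwoForest E S ∧ (S ∩ γ).card + 1 = edgeRank E γ ∧
          ((cycleMatroid E) ／ (↑γ : Set (Fin N))).Indep ((S \ γ : Finset (Fin N)) : Set (Fin N))),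
        ‖momentumFlow E S p‖ ^ 2 • ∏ e ∈ Sᶜ, (X e : MvPolynomial (Fin N) ℝ) := by
  set g : Finset (Fin N) → Finset (Fin N) → MvPolynomial (Fin N) ℝ := fun F' T' =>
    ‖∑ v ∈ univ.filter (fun v => (edgeGraph E F').Reachable a v), p v‖ ^ 2 •
      ((∏ e ∈ γ \ F', X e) * ∏ e ∈ γᶜ \ T', X e) with hg
  calc _ = ∑ F' ∈ γ.powerset.filter (fun F' : Finset (Fin N) => edgeRank E F' = F'.card ∧ F'.card + 1 = edgeRank E γ),
        ∑ T' ∈ γᶜ.powerset.filter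
            (fun T' : Finset (Fin N) => ((cycleMatroid E) ／ (↑γ : Set (Fin N))).IsBase (↑T' : Set (Fin N))),
          g F' T' := by
        rw [kirchhoffQuot, Finset.sum_mul_sum]
        refine Finset.sum_congr rfl fun F' _ => Finset.sum_congr rfl fun T' _ => ?_
        rw [hg, smul_mul_assoc]
    _ = _ := (sum_twoForests_submax_eq_sum_sum E hconn γ g).symm
    _ = _ := by
        refine Finset.sum_congr rfl fun S hS => ?_
        simp only [Finset.mem_filter, Finset.mem_univ, true_and] at hS
        simp only [hg]
        rw [← norm_momentumFlow_eq_of_contract_indep E hcons ha hS.1 hS.2.1 hS.2.2,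
          prod_sdiff_inter_mul_prod_compl_sdiff S γ]

open scoped Classical in
/-- Splitting the 2-forests that meet `γ` in fewer than `rk γ` edges into "exactly one short" and "at least two short".
[cite: Brown2017, Prop. 2.4 (proof: the classes C_1 and C_2)] -/
private theorem sum_twoForest_lt_split (γ : Finset (Fin N)) (f : Finset (Fin N) → MvPolynomial (Fin N) ℝ) :
    ∑ S ∈ univ.filter (fun S : Finset (Fin N) => IsSpanningTwoForest E S ∧ (S ∩ γ).card < edgeRank E γ), f S =
      (∑ S ∈ univ.filter (fun S : Finset (Fin N) => IsSpanningTwoForest E S ∧ (S ∩ γ).card + 1 = edgeRank E γ), f S) +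
        ∑ S ∈ univ.filter (fun S : Finset (Fin N) => IsSpanningTwoForest E S ∧ (S ∩ γ).card + 2 ≤ edgeRank E γ),
          f S := by
  rw [← Finset.sum_filter_add_sum_filter_not
    (univ.filter (fun S : Finset (Fin N) => IsSpanningTwoForest E S ∧ (S ∩ γ).card < edgeRank E γ))
    (fun S : Finset (Fin N) => (S ∩ γ).card + 1 = edgeRank E γ), Finset.filter_filter, Finset.filter_filter]
  congr 1
  · refine Finset.sum_congr (Finset.filter_congr fun S _ => ?_) fun _ _ => rfl
    constructor
    · rintro ⟨⟨hS, -⟩, h⟩; exact ⟨hS, h⟩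
    · rintro ⟨hS, h⟩; exact ⟨⟨hS, by omega⟩, h⟩
  · refine Finset.sum_congr (Finset.filter_congr fun S _ => ?_) fun _ _ => rfl
    constructor
    · rintro ⟨⟨hS, h1⟩, h2⟩; exact ⟨hS, by omega⟩
    · rintro ⟨hS, h⟩; exact ⟨⟨hS, by omega⟩, by omega⟩

open scoped Classical in
/-- Splitting the "one short" 2-forests by whether their outside part spans `G/γ` (class `C_1`) or not (flow zero).
[cite: Brown2017, Prop. 2.4 (proof)] -/
private theorem sum_twoForest_submax_split (γ : Finset (Fin N)) (f : Finset (Fin N) → MvPolynomial (Fin N) ℝ) :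
    ∑ S ∈ univ.filter (fun S : Finset (Fin N) => IsSpanningTwoForest E S ∧ (S ∩ γ).card + 1 = edgeRank E γ), f S =
      (∑ S ∈ univ.filter (fun S : Finset (Fin N) => IsSpanningTwoForest E S ∧ (S ∩ γ).card + 1 = edgeRank E γ ∧
          ((cycleMatroid E) ／ (↑γ : Set (Fin N))).Indep ((S \ γ : Finset (Fin N)) : Set (Fin N))), f S) +
        ∑ S ∈ univ.filter (fun S : Finset (Fin N) => IsSpanningTwoForest E S ∧ (S ∩ γ).card + 1 = edgeRank E γ ∧
          ¬ ((cycleMatroid E) ／ (↑γ : Set (Fin N))).Indep ((S \ γ : Finset (Fin N)) : Set (Fin N))), f S := by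
  rw [← Finset.sum_filter_add_sum_filter_not
    (univ.filter (fun S : Finset (Fin N) => IsSpanningTwoForest E S ∧ (S ∩ γ).card + 1 = edgeRank E γ))
    (fun S : Finset (Fin N) => ((cycleMatroid E) ／ (↑γ : Set (Fin N))).Indep ((S \ γ : Finset (Fin N)) : Set (Fin N))),
    Finset.filter_filter, Finset.filter_filter]
  congr 1
  · exact Finset.sum_congr (Finset.filter_congr fun S _ => and_assoc) fun _ _ => rfl
  · exact Finset.sum_congr (Finset.filter_congr fun S _ => and_assoc) fun _ _ => rfl

end IRPieces

section IR

variable {W : Type*} [NormedAddCommGroup W]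

open scoped Classical in
/-- **Brown 2017 Theorem 2.7, the IR line, with the remainder EXPLICIT: for `γ` mass-momentum spanning,
`Ξ_G(q,m) = Ξ_γ(q,m) · Ψ_{G/γ} + R^{Ξ,IR}_{γ,G}(q,m)`** (Prop. 2.4 "Φ_G(q) = Φ_γ(q) Ψ_{G/γ} + R^{Φ,IR}_{γ,G}(q)" is the case
`m = 0`; Brown's proof: "combine the factorization formula for Ψ with the IR-factorization formula (IRfactPhi), use the condition
m_e ≠ 0 ⇒ e ∈ E_γ, and set R^{Ξ,IR}_{γ,G} = R^{Φ,IR}_{γ,G}(q) + (Σ_e m_e² α_e) R^Ψ_{γ,G}"), where the remainder is: the spanning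
2-forests meeting `γ` in at most `rk γ − 2` edges (class `C_2`: "T ∩ γ' has at least 3 components, or some T ∩ γ_i has at least 2
components"), plus the `γ`-masses times `R^Ψ` (spanning trees meeting `γ` in fewer than `rk γ` edges). The 2-forests meeting `γ`
maximally, and those one short whose outside part does not span `G/γ`, have flow ZERO by momentum conservation
(`momentumFlow_eq_zero_of_card_inter_eq`, `momentumFlow_eq_zero_of_not_contract_indep`) — "Monomials in Φ_G(q) are in
one-to-one correspondence with spanning 2-trees T = T_1 ∪ T_2 such that (q^{T_1})² ≠ 0". Hypotheses: connected edge list,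
conserved momenta (Euclidean, NOT necessarily generic), `γ` m.m. in the combinatorial sense, `a` a vertex reaching every
momentum-carrying vertex inside `γ` (any vertex of the momentum component; any vertex at all if all momenta vanish).
[cite: Brown2017, Prop. 2.4 eq. (IRfactPhi) and its proof, Thm 2.7 eq. (XiIRfact) and its proof (arXiv:1512.06409 §2.2–2.3); Schultka2018, Proposition 4.11 (1),(4),(5) and proof sketch (toricfeynman.tex l.2236–2308)] -/
theorem secondSymanzik_eq_sub_mul_kirchhoffQuot_add (hconn : IsConnectedEdgeList E) {γ : Finset (Fin N)}
    {p : Fin (V + 1) → W} (hcons : ∑ v, p v = 0) {m : Fin N → ℝ} (hmm : IsMassMomentumSpanning E p m γ)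
    {a : Fin (V + 1)} (ha : ∀ v, p v ≠ 0 → (edgeGraph E γ).Reachable a v) :
    secondSymanzikPolynomial E p m =
      secondSymanzikSub E γ p m a * kirchhoffQuot E γ +
        ((∑ S ∈ univ.filter (fun S : Finset (Fin N) => IsSpanningTwoForest E S ∧ (S ∩ γ).card + 2 ≤ edgeRank E γ),
            ‖momentumFlow E S p‖ ^ 2 • ∏ e ∈ Sᶜ, (X e : MvPolynomial (Fin N) ℝ)) +
          (∑ T ∈ univ.filter (fun T : Finset (Fin N) => IsSpanningTree E T ∧ (T ∩ γ).card < edgeRank E γ),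
              ∏ e ∈ Tᶜ, (X e : MvPolynomial (Fin N) ℝ)) * ∑ e ∈ γ, m e ^ 2 • X e) := by
  -- the vanishing classes
  have hmax : ∑ S ∈ univ.filter (fun S : Finset (Fin N) => IsSpanningTwoForest E S ∧ (S ∩ γ).card = edgeRank E γ),
      ‖momentumFlow E S p‖ ^ 2 • ∏ e ∈ Sᶜ, (X e : MvPolynomial (Fin N) ℝ) = 0 := by
    refine Finset.sum_eq_zero fun S hS => ?_
    simp only [Finset.mem_filter, Finset.mem_univ, true_and] at hS
    rw [momentumFlow_eq_zero_of_card_inter_eq E hcons ha hS.1.2 hS.2, norm_zero]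
    simp
  have hdep : ∑ S ∈ univ.filter (fun S : Finset (Fin N) => IsSpanningTwoForest E S ∧ (S ∩ γ).card + 1 = edgeRank E γ ∧
      ¬ ((cycleMatroid E) ／ (↑γ : Set (Fin N))).Indep ((S \ γ : Finset (Fin N)) : Set (Fin N))),
        ‖momentumFlow E S p‖ ^ 2 • ∏ e ∈ Sᶜ, (X e : MvPolynomial (Fin N) ℝ) = 0 := by
    refine Finset.sum_eq_zero fun S hS => ?_
    simp only [Finset.mem_filter, Finset.mem_univ, true_and] at hS
    rw [momentumFlow_eq_zero_of_not_contract_indep E hcons ha hS.1 hS.2.1 hS.2.2, norm_zero]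
    simp
  have hmass : (∑ e ∈ γᶜ, m e ^ 2 • (X e : MvPolynomial (Fin N) ℝ)) = 0 := by
    refine Finset.sum_eq_zero fun e he => ?_
    have hme : m e = 0 := by
      by_contra h
      exact (Finset.mem_compl.1 he) (hmm.1 e h)
    rw [hme]
    simp
  have hm : (∑ e, m e ^ 2 • (X e : MvPolynomial (Fin N) ℝ)) =
      (∑ e ∈ γᶜ, m e ^ 2 • X e) + ∑ e ∈ γ, m e ^ 2 • X e := (Finset.sum_compl_add_sum γ _).symm
  rw [secondSymanzikSub, add_mul, mul_assoc, mul_comm (∑ e ∈ γ, m e ^ 2 • (X e : MvPolynomial (Fin N) ℝ)),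
    ← mul_assoc, kirchhoffSub_mul_kirchhoffQuot E hconn, twoForestSub_mul_kirchhoffQuot E hconn γ hcons ha,
    secondSymanzikPolynomial, sum_twoForest_split E γ, hmax, sum_twoForest_lt_split E γ, sum_twoForest_submax_split E γ,
    hdep, kirchhoffPolynomial_split E γ, hm, hmass]
  ring

open scoped Classical in
/-- **"where R^{Ξ,IR}_{γ,G}(q,m) has degree > h_γ + 1 in the α_e, e ∈ E_γ"**: for `γ` m.m., every monomial of `Ξ_G − Ξ_γ Ψ_{G/γ}`
carries at least `h_γ + 2` variables of `γ` (class `C_2`: "h_γ + (κ_{T∩γ'} − 1) + Σ_i (κ_{T∩γ_i} − 1), which is strictly greater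
than h_γ + 1"; a `γ`-mass on a monomial of `R^Ψ` adds one to a degree `> h_γ`). [cite: Brown2017, Thm 2.7 eq. (XiIRfact), Prop. 2.4 (arXiv:1512.06409 §2.2–2.3); Schultka2018, Proposition 4.11 (1) ("deg_γ(R^Φ_{G|γ}) > h¹_γ + δ^{mm}_γ", δ = 1)] -/
theorem le_gammaDeg_of_mem_support_ir_remainder (hconn : IsConnectedEdgeList E) {γ : Finset (Fin N)}
    {p : Fin (V + 1) → W} (hcons : ∑ v, p v = 0) {m : Fin N → ℝ} (hmm : IsMassMomentumSpanning E p m γ)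
    {a : Fin (V + 1)} (ha : ∀ v, p v ≠ 0 → (edgeGraph E γ).Reachable a v) {d : Fin N →₀ ℕ}
    (hd : d ∈ (secondSymanzikPolynomial E p m - secondSymanzikSub E γ p m a * kirchhoffQuot E γ).support) :
    loopNumber E γ + 2 ≤ ∑ e ∈ γ, d e := by
  rw [secondSymanzik_eq_sub_mul_kirchhoffQuot_add E hconn hcons hmm ha, add_sub_cancel_left] at hd
  have hℓ : loopNumber E γ = γ.card - edgeRank E γ := rfl
  have hrk : edgeRank E γ ≤ γ.card := edgeRank_le_card E γ
  have hsplit : ∀ S : Finset (Fin N), (γ ∩ Sᶜ).card + (S ∩ γ).card = γ.card := fun S => by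
    rw [← Finset.sdiff_eq_inter_compl, Finset.inter_comm, Finset.card_sdiff_add_card_inter]
  refine forall_mem_support_add (P := fun d => loopNumber E γ + 2 ≤ ∑ e ∈ γ, d e) ?_ ?_ d hd
  · refine forall_mem_support_sum fun S hS => forall_mem_support_smul fun d hd => ?_
    have hle : (S ∩ γ).card + 2 ≤ edgeRank E γ := (Finset.mem_filter.1 hS).2.2
    rw [gammaDeg_of_mem_support_prod_X _ γ d hd]
    have := hsplit S
    omega
  · refine forall_mem_support_mul (P := fun d => loopNumber E γ + 1 ≤ ∑ e ∈ γ, d e) (Q := fun d => ∑ e ∈ γ, d e = 1)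
      ?_ ?_ (fun a b ha hb => by rw [gammaDeg_add, hb]; omega)
    · refine forall_mem_support_sum fun T hT d hd => ?_
      have hlt : (T ∩ γ).card < edgeRank E γ := (Finset.mem_filter.1 hT).2.2
      rw [gammaDeg_of_mem_support_prod_X _ γ d hd]
      have := hsplit T
      omega
    · refine forall_mem_support_sum fun e he => forall_mem_support_smul fun d hd => ?_
      rw [gammaDeg_of_mem_support_X e γ d hd, if_pos he]

/-- **… while every monomial of the leading part `Ξ_γ Ψ_{G/γ}` carries exactly `h_γ + 1` variables of `γ`** ("deg Φ_γ(q) = h_γ + 1").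
[cite: Brown2017, Prop. 2.4 / Thm 2.7; Schultka2018, Proposition 4.11 (1)] -/
theorem gammaDeg_of_mem_support_secondSymanzikSub_mul_kirchhoffQuot {γ : Finset (Fin N)} {p : Fin (V + 1) → W}
    {m : Fin N → ℝ} {a : Fin (V + 1)} {d : Fin N →₀ ℕ}
    (hd : d ∈ (secondSymanzikSub E γ p m a * kirchhoffQuot E γ).support) : ∑ e ∈ γ, d e = loopNumber E γ + 1 :=
  forall_mem_support_mul (P := fun d => ∑ e ∈ γ, d e = loopNumber E γ + 1) (Q := fun d => ∑ e ∈ γ, d e = 0)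
    (R := fun d => ∑ e ∈ γ, d e = loopNumber E γ + 1)
    (fun _ hd => gammaDeg_of_mem_support_secondSymanzikSub E hd)
    (fun _ hd => gammaDeg_of_mem_support_kirchhoffQuot E hd)
    (fun a b ha hb => by rw [gammaDeg_add, ha, hb, add_zero]) d hd

open scoped Classical in
/-- **`Ξ_G|_{F_{−1_γ}} = Ξ_γ · Ψ_{G/γ}` and `deg_γ`-minimum `= h_γ + 1`, for `γ` m.m., whenever `Ξ_γ ≠ 0`** — the initial form of the
second Symanzik polynomial on the face of its Newton polytope exposed by the weight `−1_γ` of a mass-momentum spanning `γ`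
(the IR face: "the infra-red factorisations below are apparently new") is the PRODUCT `Ξ_γ Ψ_{G/γ}`, with `Ξ_γ` carrying the
kinematics and `Ψ_{G/γ}` none ("exactly one of the two Feynman graphs γ and G/γ is equivalent to a Feynman graph with non-zero
external momenta: if γ is momentum spanning it is γ"). [cite: Brown2017, §1.4 (arXiv:1512.06409 chunk p0009:L31), Prop. 2.4 / Thm 2.7 eq. (XiIRfact); Schultka2018, Proposition 4.11 (1) and Corollary 4.12; Borinsky2020, Definition 1 (tropical.tex l.302–306) and proof of Theorem 32 (l.1217–1219)] -/
theorem faceValue_and_trunc_secondSymanzik_neg_setIndicator_of_mm (hconn : IsConnectedEdgeList E) {γ : Finset (Fin N)}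
    {p : Fin (V + 1) → W} (hcons : ∑ v, p v = 0) {m : Fin N → ℝ} (hmm : IsMassMomentumSpanning E p m γ)
    {a : Fin (V + 1)} (ha : ∀ v, p v ≠ 0 → (edgeGraph E γ).Reachable a v) (hq : secondSymanzikSub E γ p m a ≠ 0) :
    faceValue (secondSymanzikPolynomial E p m) (-setIndicator γ) = -((loopNumber E γ : ℝ) + 1) ∧
      trunc (secondSymanzikPolynomial E p m) (-setIndicator γ) = secondSymanzikSub E γ p m a * kirchhoffQuot E γ := by
  refine faceValue_eq_and_trunc_eq_of_eq_add
    (r := secondSymanzikPolynomial E p m - secondSymanzikSub E γ p m a * kirchhoffQuot E γ)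
    (add_sub_cancel _ _).symm (mul_ne_zero hq (kirchhoffQuot_ne_zero E γ)) (fun d hd => ?_) (fun d hd => ?_)
  · rw [pairing_neg_setIndicator, gammaDeg_of_mem_support_secondSymanzikSub_mul_kirchhoffQuot E hd]
    push_cast
    ring
  · rw [pairing_neg_setIndicator, show -((loopNumber E γ : ℝ) + 1) = -(((loopNumber E γ + 1 : ℕ) : ℝ)) by push_cast; ring,
      neg_lt_neg_iff]
    exact_mod_cast Nat.lt_of_succ_le (le_gammaDeg_of_mem_support_ir_remainder E hconn hcons hmm ha hd)

open scoped Classical in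
/-- **The IR face of `NP_{Φ_G}` for an m.m. subgraph is a product face**: for a connected edge list with conserved GENERIC Euclidean
momenta, `γ` mass-momentum spanning and `a` a vertex of its momentum component (or any vertex if all momenta vanish),
`Φ_G|_{F_{−1_γ}} = Ξ_γ · Ψ_{G/γ}` — Borinsky's proof of Theorem 32, the branch `z_Φ(γ) = ℓ(γ) + 1` ("follows directly from the
factorization laws [Brown, Prop. 2.2, Prop. 2.4, Thm 2.7]"); genericity guarantees `Ξ_γ ≠ 0` through Theorem 32's face value
`−z_Φ(γ)` (for trivial kinematics both sides vanish). [cite: Borinsky2020, Theorem 32 and its proof (tropical.tex l.1197–1219); Brown2017, Prop. 2.4 / Thm 2.7; Schultka2018, Corollary 4.12] -/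
theorem trunc_secondSymanzik_neg_setIndicator_of_isMassMomentumSpanning (hconn : IsConnectedEdgeList E)
    {p : Fin (V + 1) → W} (hcons : ∑ v, p v = 0) (hgen : IsGenericMomenta p) {m : Fin N → ℝ} {γ : Finset (Fin N)}
    (hmm : IsMassMomentumSpanning E p m γ) {a : Fin (V + 1)} (ha : ∀ v, p v ≠ 0 → (edgeGraph E γ).Reachable a v) :
    trunc (secondSymanzikPolynomial E p m) (-setIndicator γ) = secondSymanzikSub E γ p m a * kirchhoffQuot E γ := by
  classical
  by_cases hq : secondSymanzikSub E γ p m a = 0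
  · -- trivial leading part: then `Ξ_G` has no monomial of `γ`-degree `h_γ + 1`, so by Theorem 32 it vanishes altogether
    by_cases hΦ : secondSymanzikPolynomial E p m = 0
    · rw [hΦ, hq, zero_mul]
      unfold trunc
      rw [support_zero, Finset.filter_empty, Finset.sum_empty]
    · exfalso
      have h0 := not_isMassMomentumSpanning_empty_of_ne_zero hcons hΦ
      have hfv : faceValue (secondSymanzikPolynomial E p m) (-setIndicator γ) = -((loopNumber E γ : ℝ) + 1) := by
        rw [faceValue_secondSymanzikPolynomial_eq_gpSupport hconn hcons hgen hΦ]
        have h1 := lovaszExt_setIndicator (fun A => -zSecondSymanzik E p m A) γ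
        simp only [lovaszExt, neg_neg] at h1
        rw [zSecondSymanzik_empty h0, zSecondSymanzik_apply, if_pos hmm, neg_zero, sub_zero] at h1
        exact h1
      obtain ⟨d, hd, hdy⟩ := exists_pairing_eq_faceValue hΦ (-setIndicator γ)
      rw [hfv, pairing_neg_setIndicator, show -((loopNumber E γ : ℝ) + 1) = -(((loopNumber E γ + 1 : ℕ) : ℝ)) by
        push_cast; ring, neg_inj, Nat.cast_inj] at hdy
      have hR : d ∈ (secondSymanzikPolynomial E p m - secondSymanzikSub E γ p m a * kirchhoffQuot E γ).support := by
        rw [hq, zero_mul, sub_zero]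
        exact hd
      have := le_gammaDeg_of_mem_support_ir_remainder E hconn hcons hmm ha hR
      omega
  · exact (faceValue_and_trunc_secondSymanzik_neg_setIndicator_of_mm E hconn hcons hmm ha hq).2

end IR

end Literature.MathematicalPhysics.QuantumFieldTheory
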